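import Summits.CriticalPhenomena.CardyFormulaZ2.Theorems.CardyBoundaryCoulombGasHalfPlaneMarkDensityLawHalfStripRigidity
import Summits.CriticalPhenomena.CardyFormulaZ2.Theorems.CardyBoundaryCoulombGasHalfPlaneMarkDensityLawBoxExhaustionPart5
import Summits.CriticalPhenomena.CardyFormulaZ2.Theorems.CardyBoundaryCoulombGasHalfPlaneMarkDensityLawBoxExhaustionPart4
import Literature.Probability.RandomPlanarGeometry.EllipticKBasic
import Summits.CriticalPhenomena.CardyFormulaZ2.Theorems.CardyBoundaryCoulombGasHalfPlaneMarkDensityLawBoxExhaustionPart3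
import Summits.CriticalPhenomena.CardyFormulaZ2.Theses.CardyPerronTeleport

/-!
# `CardyFormulaZ2 → HalfStripCardyZ2`: the deciding crux of route CardyPerronTeleport is NECESSARY
# (crux `HalfStripCardyZ2`, stmt-CriticalPhenomena-5178; redirect crux-strategist r1, 2026-08-17)

Main results (namespace `Summit.CriticalPhenomena.CardyFormulaZ2.Cruxes.HalfStripCardyZ2.Necessity`,
sorry-free, axioms `propext`/`Classical.choice`/`Quot.sound`):

* `halfStripCardyZ2_of_cardyFormulaZ2 : CardyFormulaZ2 → HalfStripCardyZ2` — Cardy's formula for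
  bond-`ℤ²` (`p = 1/2`) in every bounded Jordan conformal rectangle implies the route's deciding crux,
  Cardy's formula on the ENDS of the lattice half-strips `{0,…,N} × ℕ`
  (`P_{1/2}[[⌊ξ₀N⌋,⌊ξ₁N⌋]×{0} ↔ [⌊ξ₂N⌋,⌊ξ₃N⌋]×{0} inside the half-strip] → F(crossRatio(-cos πξᵢ))`).
* `cardyFormulaZ2_iff_halfStripCardyZ2_and_uniqueConformalLimit : CardyFormulaZ2 ↔
  (HalfStripCardyZ2 ∧ UniqueConformalLimit)` — with the tree's deciding theorem of the route
  (`cardyFormulaZ2_of_halfStripCardyZ2_of_uniqueConformalLimit`) and `uniqueConformalLimit_of_cardyFormulaZ2`: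
  the two open binders of `closes` are JOINTLY EQUIVALENT to the conjunct (a conjunct split), and
* `halfStripCardyZ2_iff_cardyFormulaZ2_of_uniqueConformalLimit : UniqueConformalLimit →
  (HalfStripCardyZ2 ↔ CardyFormulaZ2)` — modulo the route's declared residual `X_U` the deciding crux IS
  the conjunct; `not_cardyFormulaZ2_of_not_halfStripCardyZ2` — a counterexample to the crux refutes the
  conjunct (no cheaper negation).

Proof of the necessity (parts A–C below). The half-strip `{0 < Re z < 1, Im z > 0}` is uniformised by
`w = -cos(π z)`; it is NOT a bounded Jordan domain, so `CardyFormulaZ2` is read on the Schwarz–Christoffel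
boxes `(-K(k²), K(k²)) × (0, K(1-k²))` of the tree (`scrFun k`, every modulus `0 < k < 1`;
`exists_scBox_gen`) with the four bottom marks placed at PRESCRIBED prevertices `vᵢ = -cos(π ζᵢ)`, so that
the Cardy value of each box is exactly `F(crossRatio v)` whatever `k` is. As `k → 0⁺` the relative
position `F(k²; vᵢ)/K(k²)` of the mark tends to `(2/π) arcsin vᵢ = 2ζᵢ - 1` (`tendsto_relPos`: continuity of
the incomplete elliptic integral in the parameter by dominated convergence, and `F(0; ·) = arcsin`) while
the aspect ratio `K(1-k²)/K(k²)` tends to `+∞` (`eventually_mul_ellipticK_le`, from the tree's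
`ellipticK_unbounded`): the box degenerates to the half-strip with the right marks. Part B compares, at a
mesh `K/(M+1)`, the discretised box crossing (`discreteCrossing`, G02 recipe; the sibling line's box
discretisation `…BoxExhaustionPart1–3` is used verbatim) with the crux's explicit lattice event: a box
crossing translated by `(M, -1)` is a half-strip crossing (LOWER, `bondDomainCrossingProb_le_hsProb`), and
a half-strip crossing translated by `(-⌊N/2⌋, 1)` is a crossing of a slightly WIDER box (`2M'+1 =
N + 2⌊εN⌋ + O(1)` columns) unless it climbs above height `h₁N`, which costs `≤ C h₁^{-α}` by the tree's RSW
one-arm bound `exists_real_boxToFar_le_rpow_of_le_half` (UPPER, `hsProb_le_bondDomainCrossingProb_add`).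
Part C is the `ε`-sandwich: shrink (lower) / enlarge (upper) the marks by `ε'` so that the floors and the
`o(1)` discrepancy of the relative positions are absorbed for all large `N` (elementary inequalities
`key_lo_*`, `key_up_*`), let `N → ∞` (Cardy in the fixed box along meshes `→ 0⁺`), then `ε' → 0`
(continuity of `crossRatio ∘ (-cos π·)` and of `F` on `(0,1)`).

This is a crux WORKFILE (planners do not propose `Theorems/`): a prover may land it verbatim as
`Theorems/CardyPerronTeleportHalfStripCardyZ2Necessity*.lean` (`--supports stmt-CriticalPhenomena-5178`).
-/


/-!
# Necessity of the half-strip target: analytic part (Schwarz–Christoffel boxes of every modulus)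

Work file of the redirect strategist r1 on crux `HalfStripCardyZ2` (stmt-CriticalPhenomena-5178).
Part A: the Schwarz–Christoffel box `(-K(k²), K(k²)) × (0, K(1-k²))` with four collinear bottom marks is a
conformal rectangle with an explicit uniformizing datum for EVERY modulus `0 < k < 1` (the tree's part 4 of the
box exhaustion, `k = 1/2`, verbatim for general `k`), and the degeneration `k → 0⁺`: the relative position
`F(k²; v)/K(k²)` of the bottom point with prevertex `v` tends to `(2/π) arcsin v`, while the aspect ratio
`K(1-k²)/K(k²)` tends to `+∞` (the box becomes the half-strip, whose uniformizer is `-cos(π·)`).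
-/

noncomputable section

namespace Summit.CriticalPhenomena.CardyFormulaZ2.Cruxes.HalfStripCardyZ2.Necessity

open Set Filter Topology MeasureTheory intervalIntegral
open UpperHalfPlane (upperHalfPlaneSet)
open Literature.Probability.RandomPlanarGeometry
open Summit.CriticalPhenomena.CardyFormulaZ2.Cruxes.HalfPlaneMarkDensityLaw.SketchLine

/-! ## The Schwarz–Christoffel box of modulus `k` with collinear bottom marks -/

/-- **The Schwarz–Christoffel box of modulus `k`** (`0 < k < 1`, `K = K(k²)`, `H = K(1-k²)`,
`G = F(k²; ·)`): for every strictly increasing `u : Fin 4 → (-1, 1)` the box `(-K, K) × (0, H)` with the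
collinear bottom marks `G (u i)` is a conformal rectangle with arcs `0`, `2` the bottom segments
`[G u₀, G u₁] × {0}`, `[G u₂, G u₃] × {0}` and uniformizing datum `(F_k, u)` — the tree's `exists_scBox`
(`k = 1/2`) for general modulus. [folklore] -/
theorem exists_scBox_gen {k : ℝ} (hk0 : 0 < k) (hk1 : k < 1) (u : Fin 4 → ℝ) (hu : StrictMono u)
    (hu1 : ∀ i, u i ∈ Ioo (-1 : ℝ) 1) :
    ∃ R : ConformalRectangle,
      R.carrier = Ioo (-ellipticK (k ^ 2)) (ellipticK (k ^ 2)) ×ℂ Ioo 0 (ellipticK (1 - k ^ 2)) ∧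
      R.arc 0 = {z : ℂ | z.im = 0 ∧ z.re ∈ Icc (ellipticF (k ^ 2) (u 0)) (ellipticF (k ^ 2) (u 1))} ∧
      R.arc 2 = {z : ℂ | z.im = 0 ∧ z.re ∈ Icc (ellipticF (k ^ 2) (u 2)) (ellipticF (k ^ 2) (u 3))} ∧
      ∃ φ : ConformalEquiv upperHalfPlaneSet R.carrier, R.IsUniformizing φ u := by
  have hm0 : (0 : ℝ) ≤ k ^ 2 := by positivity
  have hm1 : k ^ 2 < 1 := by nlinarith
  set p : Fin 4 → ℝ := fun i => ellipticF (k ^ 2) (u i) with hp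
  have hpmono : StrictMono p := fun i j hij =>
    strictMonoOn_ellipticF hm0 hm1 (Ioo_subset_Icc_self (hu1 i)) (Ioo_subset_Icc_self (hu1 j)) (hu hij)
  obtain ⟨R, hRc, hR0, hR2, hRpt⟩ := BoxExhaustion.exists_bottomRect (ellipticK_sq_pos hk0 hk1)
    (ellipticK_one_sub_sq_pos hk0 hk1) p hpmono (ellipticF_mem_Ioo hm0 hm1 (hu1 0)).1
    (ellipticF_mem_Ioo hm0 hm1 (hu1 3)).2
  refine ⟨R, hRc, hR0, hR2, ?_⟩
  exact BoxExhaustion.exists_isUniformizing_of_bottom_marks hk0 hk1 R hRc u hu hu1 fun i => by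
    rw [hRpt i]

/-! ## The incomplete integral at parameter `0` is `arcsin` -/

/-- `F(0; v) = arcsin v` for `0 ≤ v ≤ 1` (`∫₀ᵛ dt/√(1-t²)`). [folklore] -/
theorem ellipticF_zero_param_of_nonneg {v : ℝ} (hv0 : 0 ≤ v) (hv1 : v ≤ 1) :
    ellipticF 0 v = Real.arcsin v := by
  have hF : ellipticF 0 v = ∫ t in (0:ℝ)..v, 1 / Real.sqrt (1 - t ^ 2) := by
    unfold ellipticF
    refine intervalIntegral.integral_congr fun t _ => ?_
    simp [ellIntegrand]
  have hint : IntervalIntegrable (fun t : ℝ => 1 / Real.sqrt (1 - t ^ 2)) volume 0 v := by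
    have h1 : IntervalIntegrable (ellIntegrand 0) volume 0 v :=
      (intervalIntegrable_ellIntegrand_of_lt_one (u := 0) zero_lt_one).mono_set (by
        rw [uIcc_of_le hv0, uIcc_of_le zero_le_one]; exact Icc_subset_Icc le_rfl hv1)
    refine h1.congr fun t _ => ?_
    simp [ellIntegrand]
  rw [hF, intervalIntegral.integral_eq_sub_of_hasDerivAt_of_le hv0
    Real.continuous_arcsin.continuousOn
    (fun t ht => Real.hasDerivAt_arcsin (by linarith [ht.1]) (by linarith [ht.2] : t ≠ 1)) hint,
    Real.arcsin_zero, sub_zero]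

/-- `F(0; v) = arcsin v` on `[-1, 1]` (oddness). [folklore] -/
theorem ellipticF_zero_param {v : ℝ} (hv : v ∈ Icc (-1 : ℝ) 1) : ellipticF 0 v = Real.arcsin v := by
  rcases le_or_gt 0 v with h | h
  · exact ellipticF_zero_param_of_nonneg h hv.2
  · have h' : ellipticF 0 (-v) = Real.arcsin (-v) :=
      ellipticF_zero_param_of_nonneg (by linarith) (by linarith [hv.1])
    rw [ellipticF_neg, Real.arcsin_neg] at h'
    linarith

/-! ## Continuity of `F(m; v)` in the parameter at `m = 0` -/

/-- For fixed `v ∈ [0, 1]`, `m ↦ F(m; v)` is continuous at `m = 0` (dominated convergence with the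
majorant of `ellIntegrand_le_uniform` for `m ≤ 1/2`). [folklore] -/
theorem continuousAt_ellipticF_param {v : ℝ} (hv0 : 0 ≤ v) (hv1 : v ≤ 1) :
    ContinuousAt (fun m : ℝ => ellipticF m v) 0 := by
  have hu₁ : (1 / 2 : ℝ) < 1 := by norm_num
  have hnhds : ∀ᶠ u in 𝓝 (0 : ℝ), u < 1 / 2 := Iio_mem_nhds (by norm_num)
  show ContinuousAt (fun u => ∫ t in (0:ℝ)..v, ellIntegrand u t) 0
  refine intervalIntegral.continuousAt_of_dominated_interval
    (bound := fun t => (min 1 (1 - (1 / 2 : ℝ))) ^ (-(1 / 2 : ℝ)) * (1 - t) ^ (-(1 / 2 : ℝ)))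
    (Eventually.of_forall fun u => (measurable_ellIntegrand u).aestronglyMeasurable)
    ?_ ?_ ?_
  · refine hnhds.mono fun u hu => Eventually.of_forall fun t ht => ?_
    rw [uIoc_of_le hv0] at ht
    rw [Real.norm_eq_abs, abs_of_nonneg (ellIntegrand_nonneg u t)]
    rcases lt_or_eq_of_le (ht.2.trans hv1) with h1 | h1
    · exact ellIntegrand_le_uniform hu.le hu₁ ht.1.le h1
    · subst h1
      have h0 : (1 - (1 : ℝ)) ^ (-(1 / 2 : ℝ)) = 0 := by
        rw [sub_self, Real.zero_rpow (by norm_num)]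
      rw [h0, mul_zero]
      simp [ellIntegrand]
  · have h := (intervalIntegral.intervalIntegrable_rpow' (a := 1) (b := 1 - v)
      (show (-1 : ℝ) < -(1 / 2) by norm_num)).comp_sub_left 1
    simp only [sub_self, sub_sub_cancel] at h
    exact h.const_mul _
  · refine Eventually.of_forall fun t ht => ?_
    rw [uIoc_of_le hv0] at ht
    rcases lt_or_eq_of_le (ht.2.trans hv1) with h1 | h1
    · have h1' : 0 < 1 - t ^ 2 := by nlinarith [ht.1]
      have h2' : 0 < 1 - (0:ℝ) * t ^ 2 := by simp
      have hne : Real.sqrt ((1 - t ^ 2) * (1 - (0:ℝ) * t ^ 2)) ≠ 0 :=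
        (Real.sqrt_pos.mpr (mul_pos h1' h2')).ne'
      show ContinuousAt (fun u : ℝ => 1 / Real.sqrt ((1 - t ^ 2) * (1 - u * t ^ 2))) 0
      exact ContinuousAt.div continuousAt_const (by fun_prop) hne
    · subst h1
      have : (fun u : ℝ => ellIntegrand u 1) = fun _ => 0 := by
        funext u; simp [ellIntegrand]
      rw [this]
      exact continuousAt_const

/-! ## Degeneration `k → 0`: relative positions and aspect ratio -/

/-- **Relative position of a bottom mark in the degenerating box**: for `v ∈ [0, 1]`,
`F(k²; v)/K(k²) → (2/π)·arcsin v` as `k → 0`. [folklore] -/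
theorem tendsto_ellipticF_div_ellipticK_of_nonneg {v : ℝ} (hv0 : 0 ≤ v) (hv1 : v ≤ 1) :
    Tendsto (fun k : ℝ => ellipticF (k ^ 2) v / ellipticK (k ^ 2)) (𝓝 0)
      (𝓝 (Real.arcsin v / (Real.pi / 2))) := by
  have hsq : Tendsto (fun k : ℝ => k ^ 2) (𝓝 0) (𝓝 0) := by
    have : Continuous (fun k : ℝ => k ^ 2) := by fun_prop
    simpa using this.tendsto 0
  have hF : Tendsto (fun k : ℝ => ellipticF (k ^ 2) v) (𝓝 0) (𝓝 (Real.arcsin v)) := by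
    rw [← ellipticF_zero_param ⟨by linarith, hv1⟩]
    exact (continuousAt_ellipticF_param hv0 hv1).tendsto.comp hsq
  have hK : Tendsto (fun k : ℝ => ellipticK (k ^ 2)) (𝓝 0) (𝓝 (Real.pi / 2)) := by
    rw [← ellipticK_zero]
    exact (continuousAt_ellipticK zero_lt_one).tendsto.comp hsq
  exact hF.div hK (by positivity)

/-- Same for `v ∈ [-1, 1]` (oddness of `F` and `arcsin`). [folklore] -/
theorem tendsto_ellipticF_div_ellipticK {v : ℝ} (hv : v ∈ Icc (-1 : ℝ) 1) :
    Tendsto (fun k : ℝ => ellipticF (k ^ 2) v / ellipticK (k ^ 2)) (𝓝 0)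
      (𝓝 (Real.arcsin v / (Real.pi / 2))) := by
  rcases le_or_gt 0 v with h | h
  · exact tendsto_ellipticF_div_ellipticK_of_nonneg h hv.2
  · have h' := tendsto_ellipticF_div_ellipticK_of_nonneg (v := -v) (by linarith) (by linarith [hv.1])
    have e1 : (fun k : ℝ => ellipticF (k ^ 2) v / ellipticK (k ^ 2)) =
        fun k => -(ellipticF (k ^ 2) (-v) / ellipticK (k ^ 2)) := by
      funext k; rw [ellipticF_neg]; ring
    rw [e1, show Real.arcsin v / (Real.pi / 2) = -(Real.arcsin (-v) / (Real.pi / 2)) by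
      rw [Real.arcsin_neg]; ring]
    exact h'.neg

/-- The half-strip uniformizer on the bottom side: `arcsin(-cos(π ζ)) = π ζ - π/2` for `ζ ∈ [0, 1]`,
so the prevertex `-cos(π ζ)` has limiting relative position `2ζ - 1`. [folklore] -/
theorem arcsin_neg_cos_div {ζ : ℝ} (hζ : ζ ∈ Icc (0 : ℝ) 1) :
    Real.arcsin (-Real.cos (Real.pi * ζ)) / (Real.pi / 2) = 2 * ζ - 1 := by
  have hpi : 0 < Real.pi := Real.pi_pos
  have e : -Real.cos (Real.pi * ζ) = Real.sin (Real.pi * ζ - Real.pi / 2) := by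
    rw [Real.sin_sub_pi_div_two]
  rw [e, Real.arcsin_sin (by nlinarith [hζ.1]) (by nlinarith [hζ.2])]
  field_simp

/-- `-cos(π ζ) ∈ [-1, 1]`. [folklore] -/
theorem neg_cos_mem_Icc (ζ : ℝ) : -Real.cos (Real.pi * ζ) ∈ Icc (-1 : ℝ) 1 :=
  ⟨by linarith [Real.cos_le_one (Real.pi * ζ)], by linarith [Real.neg_one_le_cos (Real.pi * ζ)]⟩

/-- `-cos(π ζ) ∈ (-1, 1)` for `ζ ∈ (0, 1)`. [folklore] -/
theorem neg_cos_mem_Ioo {ζ : ℝ} (hζ : ζ ∈ Ioo (0 : ℝ) 1) : -Real.cos (Real.pi * ζ) ∈ Ioo (-1 : ℝ) 1 := by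
  have hpi : 0 < Real.pi := Real.pi_pos
  have h1 : 0 < Real.pi * ζ := by nlinarith [hζ.1]
  have h2 : Real.pi * ζ < Real.pi := by nlinarith [hζ.2]
  have hlt : Real.cos (Real.pi * ζ) < 1 := by
    rw [← Real.cos_zero]
    exact Real.cos_lt_cos_of_nonneg_of_le_pi le_rfl h2.le h1
  have hgt : -1 < Real.cos (Real.pi * ζ) := by
    rw [← Real.cos_pi]
    exact Real.cos_lt_cos_of_nonneg_of_le_pi h1.le le_rfl h2
  exact ⟨by linarith, by linarith⟩

/-- **Relative positions of the half-strip marks**: for `ζ ∈ [0,1]`,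
`F(k²; -cos πζ)/K(k²) → 2ζ - 1` as `k → 0`. [folklore] -/
theorem tendsto_relPos {ζ : ℝ} (hζ : ζ ∈ Icc (0 : ℝ) 1) :
    Tendsto (fun k : ℝ => ellipticF (k ^ 2) (-Real.cos (Real.pi * ζ)) / ellipticK (k ^ 2)) (𝓝 0)
      (𝓝 (2 * ζ - 1)) := by
  rw [← arcsin_neg_cos_div hζ]
  exact tendsto_ellipticF_div_ellipticK (neg_cos_mem_Icc ζ)

/-- **The box becomes tall**: for every `h₀`, eventually as `k → 0⁺` the aspect ratio satisfies
`h₀ · K(k²) ≤ K(1-k²)` (`K(k²) ≤ K(1/4)` for `k < 1/2`, `K(1-k²) → ∞`). [folklore] -/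
theorem eventually_mul_ellipticK_le (h₀ : ℝ) :
    ∀ᶠ k in 𝓝[>] (0 : ℝ), h₀ * ellipticK (k ^ 2) ≤ ellipticK (1 - k ^ 2) := by
  obtain ⟨u₀, hu₀0, hu₀1, hM⟩ := ellipticK_unbounded (h₀ * ellipticK (1 / 4))
  have hpos : 0 < 1 - u₀ := by linarith
  have h1 : ∀ᶠ k in 𝓝[>] (0 : ℝ), k < min (1 / 2) (Real.sqrt (1 - u₀)) :=
    nhdsWithin_le_nhds (Iio_mem_nhds (lt_min (by norm_num) (Real.sqrt_pos.2 hpos)))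
  have h2 : ∀ᶠ k in 𝓝[>] (0 : ℝ), 0 < k := self_mem_nhdsWithin
  filter_upwards [h1, h2] with k hk hk0
  have hk2 : k < 1 / 2 := lt_of_lt_of_le hk (min_le_left _ _)
  have hks : k < Real.sqrt (1 - u₀) := lt_of_lt_of_le hk (min_le_right _ _)
  have hksq : k ^ 2 < 1 - u₀ := by
    have := Real.lt_sqrt hk0.le |>.1 hks
    exact this
  have hK1 : ellipticK (k ^ 2) ≤ ellipticK (1 / 4) := ellipticK_mono (by nlinarith) (by norm_num)
  have hK2 : h₀ * ellipticK (1 / 4) ≤ ellipticK (1 - k ^ 2) := hM _ (by linarith) (by nlinarith)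
  rcases le_or_gt 0 h₀ with hh | hh
  · calc h₀ * ellipticK (k ^ 2) ≤ h₀ * ellipticK (1 / 4) := mul_le_mul_of_nonneg_left hK1 hh
      _ ≤ _ := hK2
  · calc h₀ * ellipticK (k ^ 2) ≤ 0 := mul_nonpos_of_nonpos_of_nonneg hh.le (ellipticK_nonneg _)
      _ ≤ _ := ellipticK_nonneg _

end Summit.CriticalPhenomena.CardyFormulaZ2.Cruxes.HalfStripCardyZ2.Necessity

end

/-!
# Necessity of the half-strip target: lattice part (the half-strip versus discretised boxes)

Work file of the redirect strategist r1 on crux `HalfStripCardyZ2` (stmt-CriticalPhenomena-5178), part B.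
For a conformal rectangle `R` whose carrier is the box `(-K, K) × (0, H)` and whose arcs `0`, `2` are bottom
segments `[s₀, s₁] × {0}`, `[s₂, s₃] × {0}`, at a mesh `δ` with `K ≤ δ (M + 1)`:

* LOWER: `bondDomainCrossingProb R δ ≤ P_N(ξ)` — a crossing of `Ω_δ` translated by `(M, -1)` is a crossing of
  the lattice half-strip `{0,…,N} × ℕ` (`2M ≤ N`) between the bottom arcs, when the discrete arcs land inside them;
* UPPER: `P_N(ξ) ≤ bondDomainCrossingProb R δ + P[escape]` — a half-strip crossing translated by `(-T, 1)` either
  stays below height `H/δ - 1` (then it is a crossing of `Ω_δ`, when the bottom arcs land inside the discrete arcs)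
  or joins `Λ_N` to the complement of `Λ_{R'}`.
The sibling line's parts 1–3 (box discretisation) are used verbatim.
-/

noncomputable section

namespace Summit.CriticalPhenomena.CardyFormulaZ2.Cruxes.HalfStripCardyZ2.Necessity

open Set Metric Complex MeasureTheory Filter
open Literature.Probability.LatticeModels
open Literature.Probability.Percolation hiding cardyFunction
open Literature.Probability.RandomPlanarGeometry (ConformalRectangle cardyFunction crossRatio)
open Summit.CriticalPhenomena.CardyFormulaZ2.Theorems.HalfPlaneMarkDensityLaw.Negative (μ)
open Summit.CriticalPhenomena.CardyFormulaZ2.Cruxes.HalfPlaneMarkDensityLaw.SketchLine.BoxExhaustion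
open scoped Topology

/-! ## The half-strip vocabulary of the crux -/

/-- The lattice half-strip `{0, …, N} × ℕ` of the crux. [folklore] -/
def hsDom (N : ℕ) : Set (Site 2) := {v : Site 2 | 0 ≤ v 0 ∧ v 0 ≤ (N : ℤ) ∧ 0 ≤ v 1}

/-- The bottom arc `[⌊aN⌋, ⌊bN⌋] × {0}` of the crux (natural-number floors). [folklore] -/
def hsArc (a b : ℝ) (N : ℕ) : Set (Site 2) :=
  {v : Site 2 | v 1 = 0 ∧ ((⌊a * (N : ℝ)⌋₊ : ℕ) : ℤ) ≤ v 0 ∧ v 0 ≤ ((⌊b * (N : ℝ)⌋₊ : ℕ) : ℤ)}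

/-- The half-strip crossing probability `P_N(ξ)` of the crux. [folklore] -/
def hsProb (ξ : Fin 4 → ℝ) (N : ℕ) : ℝ :=
  μ.real (openCrossing (hsDom N) (hsArc (ξ 0) (ξ 1) N) (hsArc (ξ 2) (ξ 3) N))

/-- The crux `HalfStripCardyZ2`, read in this vocabulary (definitional). [folklore] -/
theorem halfStripCardyZ2_iff :
    Summit.CriticalPhenomena.CardyFormulaZ2.Theses.CardyPerronTeleport.HalfStripCardyZ2 ↔
      ∀ ξ : Fin 4 → ℝ, StrictMono ξ → 0 ≤ ξ 0 → ξ 3 ≤ 1 →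
        Tendsto (hsProb ξ) atTop
          (𝓝 (cardyFunction (crossRatio fun i => -Real.cos (Real.pi * ξ i)))) :=
  Iff.rfl

/-! ## LOWER: a crossing of the discretised box is a half-strip crossing -/

/-- A crossing of the discretised box between the discrete arcs of the bottom segments, translated by
`(M, -1)`, is a crossing of the lattice half-strip `{0,…,N} × ℕ` between the bottom arcs of the crux —
provided `K ≤ δ(M+1)` (the box has at most `2M+1 ≤ N+1` columns) and the discrete arcs land inside the
target arcs. [folklore] -/
theorem discreteCrossing_subset_shift_halfStrip {K H δ : ℝ} (hK : 0 < K) (hδ : 0 < δ) (hH2 : 2 * δ < H)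
    {M N : ℕ} (hKM : K ≤ δ * ((M : ℝ) + 1)) (hMN : 2 * M ≤ N)
    {s₀ s₁ s₂ s₃ : ℝ} (hs01 : s₀ ≤ s₁) (hs23 : s₂ ≤ s₃) (h0 : -K < s₀ - δ) (h1 : s₁ + δ < K)
    (h2 : -K < s₂ - δ) (h3 : s₃ + δ < K) {a b c d : ℝ}
    (ha : ∀ m : ℤ, s₀ ≤ δ * m → ((⌊a * (N : ℝ)⌋₊ : ℕ) : ℤ) ≤ m + M)
    (hb : ∀ m : ℤ, δ * m ≤ s₁ → m + M ≤ ((⌊b * (N : ℝ)⌋₊ : ℕ) : ℤ))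
    (hc : ∀ m : ℤ, s₂ ≤ δ * m → ((⌊c * (N : ℝ)⌋₊ : ℕ) : ℤ) ≤ m + M)
    (hd : ∀ m : ℤ, δ * m ≤ s₃ → m + M ≤ ((⌊d * (N : ℝ)⌋₊ : ℕ) : ℤ)) :
    discreteCrossing (Ioo (-K) K ×ℂ Ioo 0 H) δ
        {z : ℂ | z.im = 0 ∧ z.re ∈ Icc s₀ s₁} {z : ℂ | z.im = 0 ∧ z.re ∈ Icc s₂ s₃} ⊆
      openCrossing ((· + (![-(M : ℤ), 1] : Site 2)) '' hsDom N)
        ((· + (![-(M : ℤ), 1] : Site 2)) '' hsArc a b N)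
        ((· + (![-(M : ℤ), 1] : Site 2)) '' hsArc c d N) := by
  rintro ω ⟨x, hx, z, hz, hr⟩
  obtain ⟨hx1, hxa, hxb⟩ := discreteArc_boxDomain_subset hδ hK hH2 hs01 h0 h1 hx
  obtain ⟨hz1, hzc, hzd⟩ := discreteArc_boxDomain_subset hδ hK hH2 hs23 h2 h3 hz
  have hxD : x ∈ meshDomain (Ioo (-K) K ×ℂ Ioo 0 H) δ :=
    meshBoundary_subset_meshDomain _ _ (discreteArc_subset_meshBoundary _ _ _ hx)
  have hconn := openConnIn_meshDomain_of_reachable hxD hr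
  rw [meshDomain_boxDomain hδ] at hconn
  refine ⟨x, ?_, z, ?_, openConnIn_mono ?_ _ _ hconn⟩
  · rw [image_add_eq]
    show x - ![-(M : ℤ), 1] ∈ hsArc a b N
    simp only [hsArc, mem_setOf_eq, Pi.sub_apply, Matrix.cons_val_one, Matrix.cons_val_zero,
      Matrix.cons_val_fin_one, sub_neg_eq_add]
    exact ⟨by rw [hx1]; ring, ha _ hxa, hb _ hxb⟩
  · rw [image_add_eq]
    show z - ![-(M : ℤ), 1] ∈ hsArc c d N
    simp only [hsArc, mem_setOf_eq, Pi.sub_apply, Matrix.cons_val_one, Matrix.cons_val_zero,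
      Matrix.cons_val_fin_one, sub_neg_eq_add]
    exact ⟨by rw [hz1]; ring, hc _ hzc, hd _ hzd⟩
  · intro v hv
    rw [image_add_eq]
    show v - ![-(M : ℤ), 1] ∈ hsDom N
    obtain ⟨⟨hv0a, hv0b⟩, hv1a, -⟩ := mem_meshVertices_boxDomain.1 hv
    simp only [hsDom, mem_setOf_eq, Pi.sub_apply, Matrix.cons_val_one, Matrix.cons_val_zero,
      Matrix.cons_val_fin_one, sub_neg_eq_add, sub_nonneg]
    have hv1 : 1 ≤ v 1 := one_le_of_mul_pos hδ hv1a
    have hlow : -(((M : ℤ) : ℝ) + 1) < v 0 := by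
      have : -(δ * ((M : ℝ) + 1)) < δ * v 0 := by linarith
      have e : -(δ * ((M : ℝ) + 1)) = δ * (-((M : ℝ) + 1)) := by ring
      rw [e] at this
      have := lt_of_mul_lt_mul_left this hδ.le
      exact_mod_cast this
    have hup : (v 0 : ℝ) < (M : ℝ) + 1 := by
      have : δ * v 0 < δ * ((M : ℝ) + 1) := by linarith
      exact lt_of_mul_lt_mul_left this hδ.le
    have hlow' : -((M : ℤ) + 1) < v 0 := by exact_mod_cast hlow
    have hup' : v 0 < (M : ℤ) + 1 := by exact_mod_cast hup
    refine ⟨by omega, ?_, hv1⟩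
    have hMN' : (2 * M : ℕ) ≤ (N : ℤ) := by exact_mod_cast hMN
    push_cast at hMN'
    omega

/-- **LOWER bound.** For a conformal rectangle whose carrier is the box `(-K, K) × (0, H)` and whose arcs
`0`, `2` are the bottom segments `[s₀, s₁] × {0}`, `[s₂, s₃] × {0}`: `bondDomainCrossingProb R δ ≤ P_N(ξ)`
under the hypotheses of `discreteCrossing_subset_shift_halfStrip` (translation invariance of `P_{1/2}`).
[folklore] -/
theorem bondDomainCrossingProb_le_hsProb {K H δ : ℝ} (hK : 0 < K) (hδ : 0 < δ) (hH2 : 2 * δ < H)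
    {M N : ℕ} (hKM : K ≤ δ * ((M : ℝ) + 1)) (hMN : 2 * M ≤ N)
    {s₀ s₁ s₂ s₃ : ℝ} (hs01 : s₀ ≤ s₁) (hs23 : s₂ ≤ s₃) (h0 : -K < s₀ - δ) (h1 : s₁ + δ < K)
    (h2 : -K < s₂ - δ) (h3 : s₃ + δ < K) {ξ : Fin 4 → ℝ}
    (ha : ∀ m : ℤ, s₀ ≤ δ * m → ((⌊ξ 0 * (N : ℝ)⌋₊ : ℕ) : ℤ) ≤ m + M)
    (hb : ∀ m : ℤ, δ * m ≤ s₁ → m + M ≤ ((⌊ξ 1 * (N : ℝ)⌋₊ : ℕ) : ℤ))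
    (hc : ∀ m : ℤ, s₂ ≤ δ * m → ((⌊ξ 2 * (N : ℝ)⌋₊ : ℕ) : ℤ) ≤ m + M)
    (hd : ∀ m : ℤ, δ * m ≤ s₃ → m + M ≤ ((⌊ξ 3 * (N : ℝ)⌋₊ : ℕ) : ℤ))
    (R : ConformalRectangle) (hRc : R.carrier = Ioo (-K) K ×ℂ Ioo 0 H)
    (hR0 : R.arc 0 = {z : ℂ | z.im = 0 ∧ z.re ∈ Icc s₀ s₁})
    (hR2 : R.arc 2 = {z : ℂ | z.im = 0 ∧ z.re ∈ Icc s₂ s₃}) :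
    bondDomainCrossingProb R δ ≤ hsProb ξ N := by
  rw [bondDomainCrossingProb_eq_measureReal, hRc, hR0, hR2, hsProb]
  calc _ ≤ μ.real (openCrossing ((· + (![-(M : ℤ), 1] : Site 2)) '' hsDom N)
        ((· + (![-(M : ℤ), 1] : Site 2)) '' hsArc (ξ 0) (ξ 1) N)
        ((· + (![-(M : ℤ), 1] : Site 2)) '' hsArc (ξ 2) (ξ 3) N)) :=
        measureReal_mono
          (discreteCrossing_subset_shift_halfStrip hK hδ hH2 hKM hMN hs01 hs23 h0 h1 h2 h3 ha hb hc hd)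
          (measure_ne_top _ _)
    _ = _ := real_openCrossing_shift half _ _ _ _

/-! ## UPPER: a half-strip crossing stays below the top of the box or escapes -/

/-- A crossing of the truncated lattice half-strip `{0,…,N} × {j : δ(j+1) < H}` between the bottom arcs,
translated by `(-T, 1)`, is a crossing of `Ω_δ` between the discrete arcs of bottom segments containing the
translated arcs (for a lattice configuration). [folklore] -/
theorem shift_halfStrip_subset_discreteCrossing {K H δ : ℝ} (hK : 0 < K) (hδ : 0 < δ) (hH2 : 2 * δ ≤ H)
    {T : ℤ} {N : ℕ} (hT0 : -K < δ * (-(T : ℝ))) (hTN : δ * ((N : ℝ) - T) < K)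
    {s₀ s₁ s₂ s₃ : ℝ} (h0 : -K + δ ≤ s₀) (h1 : s₁ + δ ≤ K) (h2 : -K + δ ≤ s₂) (h3 : s₃ + δ ≤ K)
    {a b c d : ℝ}
    (ha : s₀ ≤ δ * ((((⌊a * (N : ℝ)⌋₊ : ℕ) : ℤ) : ℝ) - T))
    (hb : δ * ((((⌊b * (N : ℝ)⌋₊ : ℕ) : ℤ) : ℝ) - T) ≤ s₁)
    (hc : s₂ ≤ δ * ((((⌊c * (N : ℝ)⌋₊ : ℕ) : ℤ) : ℝ) - T))
    (hd : δ * ((((⌊d * (N : ℝ)⌋₊ : ℕ) : ℤ) : ℝ) - T) ≤ s₃)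
    {ω : BondConfig (Site 2)} (hωE : ω ⊆ (zdGraph 2).edgeSet)
    (hω : ω ∈ openCrossing
      ((· + (![-T, 1] : Site 2)) '' (hsDom N ∩ {w : Site 2 | δ * ((w 1 : ℝ) + 1) < H}))
      ((· + (![-T, 1] : Site 2)) '' hsArc a b N)
      ((· + (![-T, 1] : Site 2)) '' hsArc c d N)) :
    ω ∈ discreteCrossing (Ioo (-K) K ×ℂ Ioo 0 H) δ
      {z : ℂ | z.im = 0 ∧ z.re ∈ Icc s₀ s₁} {z : ℂ | z.im = 0 ∧ z.re ∈ Icc s₂ s₃} := by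
  obtain ⟨x, hx, z, hz, hconn⟩ := hω
  rw [image_add_eq] at hx hz
  change x - ![-T, 1] ∈ hsArc a b N at hx
  change z - ![-T, 1] ∈ hsArc c d N at hz
  simp only [hsArc, mem_setOf_eq, Pi.sub_apply, Matrix.cons_val_one, Matrix.cons_val_zero,
    Matrix.cons_val_fin_one, sub_neg_eq_add, sub_eq_zero] at hx hz
  -- real forms of the arc bounds
  have hx0a : (((⌊a * (N : ℝ)⌋₊ : ℕ) : ℤ) : ℝ) - T ≤ x 0 := by
    have : (((⌊a * (N : ℝ)⌋₊ : ℕ) : ℤ) : ℝ) ≤ (x 0 : ℝ) + T := by exact_mod_cast hx.2.1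
    linarith
  have hx0b : (x 0 : ℝ) ≤ (((⌊b * (N : ℝ)⌋₊ : ℕ) : ℤ) : ℝ) - T := by
    have : (x 0 : ℝ) + T ≤ (((⌊b * (N : ℝ)⌋₊ : ℕ) : ℤ) : ℝ) := by exact_mod_cast hx.2.2
    linarith
  have hz0a : (((⌊c * (N : ℝ)⌋₊ : ℕ) : ℤ) : ℝ) - T ≤ z 0 := by
    have : (((⌊c * (N : ℝ)⌋₊ : ℕ) : ℤ) : ℝ) ≤ (z 0 : ℝ) + T := by exact_mod_cast hz.2.1
    linarith
  have hz0b : (z 0 : ℝ) ≤ (((⌊d * (N : ℝ)⌋₊ : ℕ) : ℤ) : ℝ) - T := by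
    have : (z 0 : ℝ) + T ≤ (((⌊d * (N : ℝ)⌋₊ : ℕ) : ℤ) : ℝ) := by exact_mod_cast hz.2.2
    linarith
  refine ⟨x, ?_, z, ?_, reachable_of_openConnIn_boxDomain hδ hωE (openConnIn_mono ?_ _ _ hconn)⟩
  · refine mem_discreteArc_boxDomain hδ hK hH2 h0 h1 hx.1 ?_ ?_
    · exact ha.trans (mul_le_mul_of_nonneg_left hx0a hδ.le)
    · exact (mul_le_mul_of_nonneg_left hx0b hδ.le).trans hb
  · refine mem_discreteArc_boxDomain hδ hK hH2 h2 h3 hz.1 ?_ ?_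
    · exact hc.trans (mul_le_mul_of_nonneg_left hz0a hδ.le)
    · exact (mul_le_mul_of_nonneg_left hz0b hδ.le).trans hd
  · intro v hv
    rw [image_add_eq] at hv
    change v - ![-T, 1] ∈ hsDom N ∩ {w : Site 2 | δ * ((w 1 : ℝ) + 1) < H} at hv
    simp only [hsDom, mem_inter_iff, mem_setOf_eq, Pi.sub_apply, Matrix.cons_val_one,
      Matrix.cons_val_zero, Matrix.cons_val_fin_one, sub_neg_eq_add, sub_nonneg, Int.cast_sub,
      Int.cast_one, sub_add_cancel] at hv
    obtain ⟨⟨hv0a, hv0b, hv1⟩, hvH⟩ := hv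
    rw [mem_meshVertices_boxDomain]
    have hv0a' : (0 : ℝ) ≤ (v 0 : ℝ) + T := by exact_mod_cast hv0a
    have hv0b' : (v 0 : ℝ) + T ≤ N := by exact_mod_cast hv0b
    have hv1' : (1 : ℝ) ≤ v 1 := by exact_mod_cast hv1
    refine ⟨⟨?_, ?_⟩, by positivity, hvH⟩
    · have : δ * (-(T : ℝ)) ≤ δ * v 0 := mul_le_mul_of_nonneg_left (by linarith) hδ.le
      linarith
    · have : δ * (v 0 : ℝ) ≤ δ * ((N : ℝ) - T) := mul_le_mul_of_nonneg_left (by linarith) hδ.le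
      linarith

/-- A half-strip crossing between the bottom arcs that is not a crossing of the truncated half-strip
`{0,…,N} × {j : δ(j+1) < H}` escapes: some site of `Λ_N` is joined to a site outside `Λ_{R'}` (when
`δ (R'+1) < H`). [folklore] -/
theorem hs_diff_subset_escape {H δ : ℝ} (hδ : 0 < δ) (hH2 : 2 * δ ≤ H) {N R' : ℕ} (hR' : δ * ((R' : ℝ) + 1) < H)
    {a b : ℝ} {C : Set (Site 2)} :
    openCrossing (hsDom N) (hsArc a b N) C \
        openCrossing (hsDom N ∩ {w : Site 2 | δ * ((w 1 : ℝ) + 1) < H}) (hsArc a b N) C ⊆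
      {ω | ∃ x ∈ box 2 N, ∃ y ∉ box 2 R', ω ∈ openConnIn univ x y} := by
  rintro ω ⟨⟨x, hxA, z, hzC, hconn⟩, hF⟩
  set B : Set (Site 2) := hsDom N ∩ {w : Site 2 | δ * ((w 1 : ℝ) + 1) < H} with hB
  have hxS : x ∈ hsDom N := hconn.1
  have hxA' := hxA
  simp only [hsArc, mem_setOf_eq] at hxA'
  have hxS' := hxS
  simp only [hsDom, mem_setOf_eq] at hxS'
  have hxB : x ∈ B := by
    refine ⟨hxS, ?_⟩
    show δ * ((x 1 : ℝ) + 1) < H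
    rw [hxA'.1]; push_cast; linarith
  have hnot : ω ∉ openConnIn B x z := fun h => hF ⟨x, hxA, z, hzC, h⟩
  obtain ⟨w, hwS, hwB, hw⟩ := exists_exit_of_not_openConnIn hxB hconn hnot
  refine ⟨x, ?_, w, fun hwbox => hwB ⟨hwS, ?_⟩, openConnIn_mono (subset_univ _) _ _ hw⟩
  · rw [mem_box]
    intro i
    fin_cases i
    · show -(N : ℤ) ≤ x 0 ∧ x 0 ≤ N
      exact ⟨by linarith [hxS'.1], hxS'.2.1⟩
    · show -(N : ℤ) ≤ x 1 ∧ x 1 ≤ N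
      rw [hxA'.1]
      exact ⟨by linarith, by positivity⟩
  · rw [mem_box] at hwbox
    have h1 := (hwbox 1).2
    have h1' : (w 1 : ℝ) ≤ R' := by exact_mod_cast h1
    show δ * ((w 1 : ℝ) + 1) < H
    have : δ * ((w 1 : ℝ) + 1) ≤ δ * ((R' : ℝ) + 1) := mul_le_mul_of_nonneg_left (by linarith) hδ.le
    linarith

/-- **UPPER bound.** For a conformal rectangle `R` whose carrier is the box and whose arcs `0`, `2` are
bottom segments containing the translated bottom arcs: `P_N(ξ) ≤ bondDomainCrossingProb R δ + P[Λ_N ↔ Λ_{R'}ᶜ]`.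
[folklore] -/
theorem hsProb_le_bondDomainCrossingProb_add {K H δ : ℝ} (hK : 0 < K) (hδ : 0 < δ) (hH2 : 2 * δ ≤ H)
    {T : ℤ} {N R' : ℕ} (hT0 : -K < δ * (-(T : ℝ))) (hTN : δ * ((N : ℝ) - T) < K)
    (hR' : δ * ((R' : ℝ) + 1) < H)
    {s₀ s₁ s₂ s₃ : ℝ} (h0 : -K + δ ≤ s₀) (h1 : s₁ + δ ≤ K) (h2 : -K + δ ≤ s₂) (h3 : s₃ + δ ≤ K)
    {ξ : Fin 4 → ℝ}
    (ha : s₀ ≤ δ * ((((⌊ξ 0 * (N : ℝ)⌋₊ : ℕ) : ℤ) : ℝ) - T))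
    (hb : δ * ((((⌊ξ 1 * (N : ℝ)⌋₊ : ℕ) : ℤ) : ℝ) - T) ≤ s₁)
    (hc : s₂ ≤ δ * ((((⌊ξ 2 * (N : ℝ)⌋₊ : ℕ) : ℤ) : ℝ) - T))
    (hd : δ * ((((⌊ξ 3 * (N : ℝ)⌋₊ : ℕ) : ℤ) : ℝ) - T) ≤ s₃)
    (R : ConformalRectangle) (hRc : R.carrier = Ioo (-K) K ×ℂ Ioo 0 H)
    (hR0 : R.arc 0 = {z : ℂ | z.im = 0 ∧ z.re ∈ Icc s₀ s₁})
    (hR2 : R.arc 2 = {z : ℂ | z.im = 0 ∧ z.re ∈ Icc s₂ s₃}) :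
    hsProb ξ N ≤ bondDomainCrossingProb R δ +
      μ.real {ω | ∃ x ∈ box 2 N, ∃ y ∉ box 2 R', ω ∈ openConnIn univ x y} := by
  set B : Set (Site 2) := hsDom N ∩ {w : Site 2 | δ * ((w 1 : ℝ) + 1) < H} with hB
  set E := openCrossing (hsDom N) (hsArc (ξ 0) (ξ 1) N) (hsArc (ξ 2) (ξ 3) N) with hE
  set F := openCrossing B (hsArc (ξ 0) (ξ 1) N) (hsArc (ξ 2) (ξ 3) N) with hF
  have hsplit : E ⊆ F ∪ (E \ F) := fun ω hω => by
    by_cases h : ω ∈ F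
    · exact Or.inl h
    · exact Or.inr ⟨hω, h⟩
  have hF_le : μ.real F ≤ bondDomainCrossingProb R δ := by
    have hshift := real_openCrossing_shift (d := 2) half (![-T, 1] : Site 2) B (hsArc (ξ 0) (ξ 1) N)
      (hsArc (ξ 2) (ξ 3) N)
    rw [bondDomainCrossingProb_eq_measureReal, hRc, hR0, hR2, hF]
    change μ.real _ ≤ μ.real _
    change μ.real _ = μ.real _ at hshift
    rw [← hshift]
    refine ENNReal.toReal_mono (measure_ne_top _ _) (measure_mono_ae ?_)
    filter_upwards [ae_subset_edgeSet] with ω hωE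
    intro hω
    exact shift_halfStrip_subset_discreteCrossing hK hδ hH2 hT0 hTN h0 h1 h2 h3 ha hb hc hd hωE hω
  have hdiff_le : μ.real (E \ F) ≤ μ.real {ω | ∃ x ∈ box 2 N, ∃ y ∉ box 2 R', ω ∈ openConnIn univ x y} :=
    measureReal_mono (hs_diff_subset_escape hδ hH2 hR') (measure_ne_top _ _)
  rw [hsProb]
  calc μ.real E ≤ μ.real (F ∪ (E \ F)) := measureReal_mono hsplit (measure_ne_top _ _)
    _ ≤ μ.real F + μ.real (E \ F) := measureReal_union_le _ _
    _ ≤ _ := add_le_add hF_le hdiff_le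

end Summit.CriticalPhenomena.CardyFormulaZ2.Cruxes.HalfStripCardyZ2.Necessity

end

noncomputable section

/-! ## Part C — assembly: `CardyFormulaZ2 → HalfStripCardyZ2` -/

namespace Summit.CriticalPhenomena.CardyFormulaZ2.Cruxes.HalfStripCardyZ2.Necessity

open Set Metric MeasureTheory Filter
open Literature.Probability.LatticeModels
open Literature.Probability.Percolation hiding cardyFunction
open Literature.Probability.RandomPlanarGeometry
open UpperHalfPlane (upperHalfPlaneSet)
open Summit.CriticalPhenomena.CardyFormulaZ2.Theorems.HalfPlaneMarkDensityLaw.Negative (μ)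
open Summit.CriticalPhenomena.CardyFormulaZ2.Cruxes.HalfPlaneMarkDensityLaw.SketchLine.BoxExhaustion
  (continuousAt_crossRatio crossRatio_den_ne_zero tendsto_const_mul_inv_rpow)
open scoped Topology

/-! ### The marks `vᵢ = -cos(π ζᵢ)` -/

/-- The bottom prevertices of the half-strip marks. [folklore] -/
def negCos (ζ : Fin 4 → ℝ) : Fin 4 → ℝ := fun i => -Real.cos (Real.pi * ζ i)

/-- `ζ ↦ (-cos(π ζᵢ))ᵢ` is continuous. [folklore] -/
theorem continuous_negCos : Continuous negCos := by
  refine continuous_pi fun i => ?_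
  unfold negCos
  fun_prop

/-- For `ζ` strictly increasing in `[0, 1]`, the prevertices `-cos(π ζᵢ)` are strictly increasing.
[folklore] -/
theorem strictMono_negCos {ζ : Fin 4 → ℝ} (hζ : StrictMono ζ) (h0 : 0 ≤ ζ 0) (h3 : ζ 3 ≤ 1) :
    StrictMono (negCos ζ) := by
  intro i j hij
  have hpi : 0 < Real.pi := Real.pi_pos
  have hi0 : 0 ≤ ζ i := h0.trans (hζ.monotone (Fin.zero_le i))
  have hj1 : ζ j ≤ 1 := (hζ.monotone (Fin.le_last j)).trans h3
  have hlt : Real.pi * ζ i < Real.pi * ζ j := mul_lt_mul_of_pos_left (hζ hij) hpi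
  have hcos : Real.cos (Real.pi * ζ j) < Real.cos (Real.pi * ζ i) :=
    Real.cos_lt_cos_of_nonneg_of_le_pi (by positivity) (by nlinarith) hlt
  show -Real.cos (Real.pi * ζ i) < -Real.cos (Real.pi * ζ j)
  linarith

/-- For `ζ` strictly increasing with `0 < ζ₀`, `ζ₃ < 1`, every prevertex lies in `(-1, 1)`. [folklore] -/
theorem negCos_mem_Ioo {ζ : Fin 4 → ℝ} (hζ : StrictMono ζ) (h0 : 0 < ζ 0) (h3 : ζ 3 < 1) (i : Fin 4) :
    negCos ζ i ∈ Ioo (-1 : ℝ) 1 :=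
  neg_cos_mem_Ioo ⟨h0.trans_le (hζ.monotone (Fin.zero_le i)), (hζ.monotone (Fin.le_last i)).trans_lt h3⟩

/-- **Continuity of the Cardy value in the marks**: if `ζₑ → ξ` (`ξ` strictly increasing in `[0,1]`) then
`F(crossRatio(-cos π ζₑ)) → F(crossRatio(-cos π ξ))`. [folklore] -/
theorem tendsto_cardy_negCos {ξ : Fin 4 → ℝ} (hξ : StrictMono ξ) (h0 : 0 ≤ ξ 0) (h3 : ξ 3 ≤ 1)
    {ι : Type*} {l : Filter ι} {ζ : ι → Fin 4 → ℝ} (hζ : Tendsto ζ l (𝓝 ξ)) :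
    Tendsto (fun e => cardyFunction (crossRatio (negCos (ζ e)))) l
      (𝓝 (cardyFunction (crossRatio (negCos ξ)))) := by
  have hmono := strictMono_negCos hξ h0 h3
  have hcr : ContinuousAt crossRatio (negCos ξ) := continuousAt_crossRatio (crossRatio_den_ne_zero hmono)
  have hη : crossRatio (negCos ξ) ∈ Ioo (0 : ℝ) 1 := crossRatio_mem_Ioo (Or.inl hmono)
  have hF : ContinuousAt cardyFunction (crossRatio (negCos ξ)) :=
    continuousOn_cardyFunction_Ioo.continuousAt (Ioo_mem_nhds hη.1 hη.2)
  have h1 : Tendsto (fun e => negCos (ζ e)) l (𝓝 (negCos ξ)) :=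
    (continuous_negCos.tendsto ξ).comp hζ
  exact hF.tendsto.comp (hcr.tendsto.comp h1)

/-! ### Choosing the modulus `k` -/

/-- Relative position `σᵢ = F(k²; vᵢ)/K(k²) ∈ [-1, 1]` of the bottom mark with prevertex `vᵢ ∈ [-1, 1]`.
[folklore] -/
theorem relPos_mem_Icc {k : ℝ} (hk0 : 0 < k) (hk1 : k < 1) {v : ℝ} (hv : v ∈ Icc (-1 : ℝ) 1) :
    ellipticF (k ^ 2) v / ellipticK (k ^ 2) ∈ Icc (-1 : ℝ) 1 := by
  have hm0 : (0 : ℝ) ≤ k ^ 2 := by positivity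
  have hm1 : k ^ 2 < 1 := by nlinarith
  have hK : 0 < ellipticK (k ^ 2) := ellipticK_pos hm0 hm1
  have h := ellipticF_mem_Icc hm0 hm1 hv
  constructor
  · rw [le_div_iff₀ hK]; linarith [h.1]
  · rw [div_le_iff₀ hK]; linarith [h.2]

/-- Strict relative positions: `v ∈ (-1, 1)` gives `σ ∈ (-1, 1)`. [folklore] -/
theorem relPos_mem_Ioo {k : ℝ} (hk0 : 0 < k) (hk1 : k < 1) {v : ℝ} (hv : v ∈ Ioo (-1 : ℝ) 1) :
    ellipticF (k ^ 2) v / ellipticK (k ^ 2) ∈ Ioo (-1 : ℝ) 1 := by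
  have hm0 : (0 : ℝ) ≤ k ^ 2 := by positivity
  have hm1 : k ^ 2 < 1 := by nlinarith
  have hK : 0 < ellipticK (k ^ 2) := ellipticK_pos hm0 hm1
  have h := ellipticF_mem_Ioo hm0 hm1 hv
  constructor
  · rw [lt_div_iff₀ hK]; linarith [h.1]
  · rw [div_lt_iff₀ hK]; linarith [h.2]

/-- Relative positions are monotone in the prevertex. [folklore] -/
theorem relPos_le_relPos {k : ℝ} (hk0 : 0 < k) (hk1 : k < 1) {v w : ℝ} (hv : v ∈ Icc (-1 : ℝ) 1)
    (hw : w ∈ Icc (-1 : ℝ) 1) (hvw : v ≤ w) :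
    ellipticF (k ^ 2) v / ellipticK (k ^ 2) ≤ ellipticF (k ^ 2) w / ellipticK (k ^ 2) := by
  have hm0 : (0 : ℝ) ≤ k ^ 2 := by positivity
  have hm1 : k ^ 2 < 1 := by nlinarith
  have hK : 0 < ellipticK (k ^ 2) := ellipticK_pos hm0 hm1
  exact div_le_div_of_nonneg_right ((strictMonoOn_ellipticF hm0 hm1).monotoneOn hv hw hvw) hK.le

/-- **Choice of the modulus.** For `ζ` strictly increasing in `[0,1]`, a margin `τ > 0` and an aspect bound
`h₀`, there is `0 < k < 1` with `|F(k²; -cos πζᵢ)/K(k²) - (2ζᵢ - 1)| < τ` for every `i` and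
`h₀ · K(k²) ≤ K(1-k²)`. [folklore] -/
theorem exists_modulus (ζ : Fin 4 → ℝ) (hζ0 : ∀ i, ζ i ∈ Icc (0 : ℝ) 1) {τ : ℝ} (hτ : 0 < τ) (h₀ : ℝ) :
    ∃ k : ℝ, 0 < k ∧ k < 1 ∧
      (∀ i, |ellipticF (k ^ 2) (negCos ζ i) / ellipticK (k ^ 2) - (2 * ζ i - 1)| < τ) ∧
      h₀ * ellipticK (k ^ 2) ≤ ellipticK (1 - k ^ 2) := by
  have h1 : ∀ i, ∀ᶠ k in 𝓝[>] (0 : ℝ),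
      |ellipticF (k ^ 2) (negCos ζ i) / ellipticK (k ^ 2) - (2 * ζ i - 1)| < τ := by
    intro i
    have ht := tendsto_nhdsWithin_of_tendsto_nhds (a := (0 : ℝ)) (s := Ioi 0) (tendsto_relPos (hζ0 i))
    have := (Metric.tendsto_nhds.1 ht) τ hτ
    refine this.mono fun k hk => ?_
    rwa [Real.dist_eq] at hk
  have h2 : ∀ᶠ k in 𝓝[>] (0 : ℝ), k ∈ Ioo (0 : ℝ) 1 := Ioo_mem_nhdsGT one_pos
  obtain ⟨k, hk, hk2, hk3⟩ := ((eventually_all.2 h1).and (h2.and (eventually_mul_ellipticK_le h₀))).exists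
  exact ⟨k, hk2.1, hk2.2, hk, hk3⟩

/-! ### Elementary inequalities of the lattice bookkeeping -/

/-- LOWER, left end of an arc. [folklore] -/
theorem key_lo_left {ξ e σ M m : ℝ} (hσ : 2 * ξ - 1 + e ≤ σ) (hξ : 0 ≤ ξ) (hm : σ * (M + 1) ≤ m)
    (hM : 1 ≤ e * (M + 1)) (hM0 : 0 ≤ M) : ξ * (2 * M + 1) ≤ m + M := by
  have h1 : (2 * ξ - 1 + e) * (M + 1) ≤ σ * (M + 1) := mul_le_mul_of_nonneg_right hσ (by linarith)
  nlinarith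

/-- LOWER, right end of an arc. [folklore] -/
theorem key_lo_right {ξ e σ M m : ℝ} (hσ : σ ≤ 2 * ξ - 1 - e) (hξ1 : ξ ≤ 1) (hm : m ≤ σ * (M + 1))
    (hM : 1 ≤ e * (M + 1)) (hM0 : 0 ≤ M) : m + M ≤ ξ * (2 * M) := by
  have h1 : σ * (M + 1) ≤ (2 * ξ - 1 - e) * (M + 1) := mul_le_mul_of_nonneg_right hσ (by linarith)
  nlinarith

/-- `|(2ξ-1)/(1+2e)| ≤ 1` for `ξ ∈ [0,1]`, `e ≥ 0`, in product form. [folklore] -/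
theorem rho_abs_le {ξ e : ℝ} (hξ0 : 0 ≤ ξ) (hξ1 : ξ ≤ 1) (he : 0 ≤ e) :
    |(2 * ξ - 1) / (1 + 2 * e)| ≤ 1 := by
  rw [abs_div, abs_of_pos (by linarith : (0:ℝ) < 1 + 2 * e), div_le_one (by linarith)]
  rw [abs_le]; constructor <;> linarith

/-- UPPER, left end of an arc. [folklore] -/
theorem key_up_left {ξ e σ M L : ℝ} (he0 : 0 < e) (hξ0 : 0 ≤ ξ) (hξ1 : ξ ≤ 1)
    (hσ : σ ≤ (2 * ξ - 1) / (1 + 2 * e) - e / 4) (hL1 : 2 * e * M < L) (hL2 : L ≤ 2 * e * M + 1)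
    (hM : 12 ≤ e * M) (hM0 : 0 ≤ M) : σ * (M + L + 1) ≤ (2 * ξ - 1) * M - 1 := by
  set ρ := (2 * ξ - 1) / (1 + 2 * e) with hρ
  have hρ1 : |ρ| ≤ 1 := rho_abs_le hξ0 hξ1 he0.le
  have hρe : ρ * (1 + 2 * e) = 2 * ξ - 1 := by rw [hρ]; field_simp
  have hpos : 0 ≤ M + L + 1 := by nlinarith
  have h1 : σ * (M + L + 1) ≤ (ρ - e / 4) * (M + L + 1) := mul_le_mul_of_nonneg_right hσ hpos
  set θ := L + 1 - 2 * e * M with hθ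
  have hθ1 : 0 < θ := by rw [hθ]; linarith
  have hθ2 : θ ≤ 2 := by rw [hθ]; linarith
  have e1 : (ρ - e / 4) * (M + L + 1) = ρ * (1 + 2 * e) * M + ρ * θ - e / 4 * (M + L + 1) := by
    rw [hθ]; ring
  have h2 : ρ * θ ≤ 2 := by
    have := abs_le.1 hρ1
    nlinarith
  have h3 : e / 4 * M ≤ e / 4 * (M + L + 1) := by nlinarith
  rw [e1, hρe] at h1
  nlinarith

/-- UPPER, right end of an arc. [folklore] -/
theorem key_up_right {ξ e σ M L : ℝ} (he0 : 0 < e) (hξ0 : 0 ≤ ξ) (hξ1 : ξ ≤ 1)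
    (hσ : (2 * ξ - 1) / (1 + 2 * e) + e / 4 ≤ σ) (hL1 : 2 * e * M < L) (hL2 : L ≤ 2 * e * M + 1)
    (hM : 12 ≤ e * M) (hM0 : 0 ≤ M) : ξ * (2 * M + 1) - M ≤ σ * (M + L + 1) := by
  set ρ := (2 * ξ - 1) / (1 + 2 * e) with hρ
  have hρ1 : |ρ| ≤ 1 := rho_abs_le hξ0 hξ1 he0.le
  have hρe : ρ * (1 + 2 * e) = 2 * ξ - 1 := by rw [hρ]; field_simp
  have hpos : 0 ≤ M + L + 1 := by nlinarith
  have h1 : (ρ + e / 4) * (M + L + 1) ≤ σ * (M + L + 1) := mul_le_mul_of_nonneg_right hσ hpos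
  set θ := L + 1 - 2 * e * M with hθ
  have hθ1 : 0 < θ := by rw [hθ]; linarith
  have hθ2 : θ ≤ 2 := by rw [hθ]; linarith
  have e1 : (ρ + e / 4) * (M + L + 1) = ρ * (1 + 2 * e) * M + ρ * θ + e / 4 * (M + L + 1) := by
    rw [hθ]; ring
  have h2 : -2 ≤ ρ * θ := by
    have := abs_le.1 hρ1
    nlinarith
  have h3 : e / 4 * M ≤ e / 4 * (M + L + 1) := by nlinarith
  rw [e1, hρe] at h1
  nlinarith

/-- Halving a natural number: `2 (N/2) ≤ N ≤ 2 (N/2) + 1`. [folklore] -/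
theorem two_mul_div_two_le (N : ℕ) : 2 * (N / 2) ≤ N ∧ N ≤ 2 * (N / 2) + 1 := by omega

/-- The meshes `K/(M+1) → 0⁺`. [folklore] -/
theorem tendsto_div_natSucc_nhdsWithin {K : ℝ} (hK : 0 < K) :
    Tendsto (fun M : ℕ => K / ((M : ℝ) + 1)) atTop (𝓝[>] (0 : ℝ)) := by
  rw [tendsto_nhdsWithin_iff]
  refine ⟨?_, Eventually.of_forall fun M => div_pos hK (by positivity)⟩
  have h : Tendsto (fun M : ℕ => K / ((M + 1 : ℕ) : ℝ)) atTop (𝓝 0) :=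
    (tendsto_const_div_atTop_nhds_zero_nat K).comp (tendsto_add_atTop_nat 1)
  refine h.congr fun M => ?_
  push_cast; rfl

end Summit.CriticalPhenomena.CardyFormulaZ2.Cruxes.HalfStripCardyZ2.Necessity


namespace Summit.CriticalPhenomena.CardyFormulaZ2.Cruxes.HalfStripCardyZ2.Necessity

open Set Metric MeasureTheory Filter
open Literature.Probability.LatticeModels
open Literature.Probability.Percolation hiding cardyFunction
open Literature.Probability.RandomPlanarGeometry
open UpperHalfPlane (upperHalfPlaneSet)
open Summit.CriticalPhenomena.CardyFormulaZ2.Theorems.HalfPlaneMarkDensityLaw.Negative (μ)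
open Summit.CriticalPhenomena.CardyFormulaZ2.Cruxes.HalfPlaneMarkDensityLaw.SketchLine.BoxExhaustion
  (continuousAt_crossRatio crossRatio_den_ne_zero tendsto_const_mul_inv_rpow)
open Summit.CriticalPhenomena.CardyFormulaZ2.Theses.CardyPerronTeleport (HalfStripCardyZ2 UniqueConformalLimit)
open scoped Topology

/-! ### LOWER bound: shrunk arcs -/

/-- The shrunk marks `(ξ₀ + e, ξ₁ - e, ξ₂ + e, ξ₃ - e)`. [folklore] -/
def zlo (ξ : Fin 4 → ℝ) (e : ℝ) : Fin 4 → ℝ := ![ξ 0 + e, ξ 1 - e, ξ 2 + e, ξ 3 - e]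

theorem zlo_apply (ξ : Fin 4 → ℝ) (e : ℝ) :
    zlo ξ e 0 = ξ 0 + e ∧ zlo ξ e 1 = ξ 1 - e ∧ zlo ξ e 2 = ξ 2 + e ∧ zlo ξ e 3 = ξ 3 - e := by
  simp [zlo]

/-- The shrunk marks tend to `ξ` as `e → 0⁺`. [folklore] -/
theorem tendsto_zlo (ξ : Fin 4 → ℝ) : Tendsto (zlo ξ) (𝓝[>] 0) (𝓝 ξ) := by
  have hc : Continuous (zlo ξ) := by
    refine continuous_pi fun i => ?_
    fin_cases i <;> simp [zlo] <;> fun_prop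
  have h0 : zlo ξ 0 = ξ := by
    ext i; fin_cases i <;> simp [zlo]
  have := hc.tendsto 0
  rw [h0] at this
  exact tendsto_nhdsWithin_of_tendsto_nhds this

/-- For small `e > 0` the shrunk marks are strictly increasing and interior. [folklore] -/
theorem zlo_props {ξ : Fin 4 → ℝ} (hξ : StrictMono ξ) (h0 : 0 ≤ ξ 0) (h3 : ξ 3 ≤ 1) {e : ℝ} (he : 0 < e)
    (he1 : 2 * e < ξ 1 - ξ 0) (he2 : 2 * e < ξ 3 - ξ 2) :
    StrictMono (zlo ξ e) ∧ 0 < zlo ξ e 0 ∧ zlo ξ e 3 < 1 := by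
  have h12 : ξ 1 < ξ 2 := hξ (by decide)
  refine ⟨Fin.strictMono_iff_lt_succ.2 fun i => ?_, ?_, ?_⟩
  · fin_cases i <;> simp [zlo] <;> linarith
  · simp [zlo]; linarith
  · simp [zlo]; linarith

set_option maxHeartbeats 800000 in
/-- **LOWER half of the sandwich**: eventually `F(η) - ε < P_N(ξ)`. [folklore] -/
theorem lower_eventually (hS : _root_.CardyFormulaZ2) {ξ : Fin 4 → ℝ} (hξ : StrictMono ξ)
    (h0 : 0 ≤ ξ 0) (h3 : ξ 3 ≤ 1) {ε : ℝ} (hε : 0 < ε) :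
    ∀ᶠ N : ℕ in atTop, cardyFunction (crossRatio (negCos ξ)) - ε < hsProb ξ N := by
  have hξ1 : 0 ≤ ξ 1 := h0.trans (hξ (by decide : (0 : Fin 4) < 1)).le
  have hξ2 : 0 ≤ ξ 2 := h0.trans (hξ (by decide : (0 : Fin 4) < 2)).le
  have hξ11 : ξ 1 ≤ 1 := (hξ (by decide : (1 : Fin 4) < 3)).le.trans h3
  have hξ21 : ξ 2 ≤ 1 := (hξ (by decide : (2 : Fin 4) < 3)).le.trans h3
  -- Step 1: the shrinking parameter `e`
  have hgap1 : 0 < ξ 1 - ξ 0 := sub_pos.2 (hξ (by decide))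
  have hgap2 : 0 < ξ 3 - ξ 2 := sub_pos.2 (hξ (by decide))
  have hcont := tendsto_cardy_negCos hξ h0 h3 (tendsto_zlo ξ)
  have hev1 : ∀ᶠ e in 𝓝[>] (0 : ℝ), cardyFunction (crossRatio (negCos ξ)) - ε / 2 <
      cardyFunction (crossRatio (negCos (zlo ξ e))) :=
    hcont (Ioi_mem_nhds (by linarith))
  have hev2 : ∀ᶠ e in 𝓝[>] (0 : ℝ), e ∈ Ioo 0 (min ((ξ 1 - ξ 0) / 4) ((ξ 3 - ξ 2) / 4)) :=
    Ioo_mem_nhdsGT (lt_min (by linarith) (by linarith))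
  obtain ⟨e, he1, he2⟩ := (hev1.and hev2).exists
  have he : 0 < e := he2.1
  have hea : 2 * e < ξ 1 - ξ 0 := by have := (lt_min_iff.1 he2.2).1; linarith
  have heb : 2 * e < ξ 3 - ξ 2 := by have := (lt_min_iff.1 he2.2).2; linarith
  obtain ⟨hζm, hζ0, hζ3⟩ := zlo_props hξ h0 h3 he hea heb
  obtain ⟨ez0, ez1, ez2, ez3⟩ := zlo_apply ξ e
  set ζ := zlo ξ e with hζdef
  have hζ01 : ∀ i, ζ i ∈ Icc (0 : ℝ) 1 := fun i =>
    ⟨hζ0.le.trans (hζm.monotone (Fin.zero_le i)), (hζm.monotone (Fin.le_last i)).trans hζ3.le⟩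
  -- Step 2: the modulus `k`
  obtain ⟨k, hk0, hk1, hσ, -⟩ := exists_modulus ζ hζ01 he 0
  set v := negCos ζ with hvdef
  have hvm : StrictMono v := strictMono_negCos hζm hζ0.le hζ3.le
  have hvI : ∀ i, v i ∈ Ioo (-1 : ℝ) 1 := negCos_mem_Ioo hζm hζ0 hζ3
  have hvI' : ∀ i, v i ∈ Icc (-1 : ℝ) 1 := fun i => Ioo_subset_Icc_self (hvI i)
  -- Step 3: the Schwarz–Christoffel box and Cardy's formula in it
  obtain ⟨R, hRc, hR0, hR2, φ, hφ⟩ := exists_scBox_gen hk0 hk1 v hvm hvI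
  set K := ellipticK (k ^ 2) with hKdef
  set H := ellipticK (1 - k ^ 2) with hHdef
  have hK : 0 < K := ellipticK_sq_pos hk0 hk1
  have hH : 0 < H := ellipticK_one_sub_sq_pos hk0 hk1
  have hlim : Tendsto (fun M : ℕ => bondDomainCrossingProb R (K / ((M : ℝ) + 1))) atTop
      (𝓝 (cardyFunction (crossRatio v))) :=
    (hS R φ v hφ).comp (tendsto_div_natSucc_nhdsWithin hK)
  have hevM1 : ∀ᶠ M : ℕ in atTop, cardyFunction (crossRatio v) - ε / 2 <
      bondDomainCrossingProb R (K / ((M : ℝ) + 1)) :=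
    hlim (Ioi_mem_nhds (by linarith))
  -- relative positions `σ i = F(k²; v i)/K`
  set σ : Fin 4 → ℝ := fun i => ellipticF (k ^ 2) (v i) / K with hσdef
  have hσi : ∀ i, ellipticF (k ^ 2) (v i) / K = σ i := fun i => rfl
  have hsσ : ∀ i, ellipticF (k ^ 2) (v i) = K * σ i := fun i => by
    rw [← hσi]; field_simp
  have hσI : ∀ i, σ i ∈ Ioo (-1 : ℝ) 1 := fun i => relPos_mem_Ioo hk0 hk1 (hvI i)
  have hσmono : ∀ i j, i ≤ j → σ i ≤ σ j := fun i j hij =>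
    relPos_le_relPos hk0 hk1 (hvI' i) (hvI' j) (hvm.monotone hij)
  have hσ0 : 2 * ξ 0 - 1 + e ≤ σ 0 := by
    have := (abs_lt.1 (hσ 0)).1; rw [ez0, hσi] at this; linarith
  have hσ1 : σ 1 ≤ 2 * ξ 1 - 1 - e := by
    have := (abs_lt.1 (hσ 1)).2; rw [ez1, hσi] at this; linarith
  have hσ2 : 2 * ξ 2 - 1 + e ≤ σ 2 := by
    have := (abs_lt.1 (hσ 2)).1; rw [ez2, hσi] at this; linarith
  have hσ3 : σ 3 ≤ 2 * ξ 3 - 1 - e := by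
    have := (abs_lt.1 (hσ 3)).2; rw [ez3, hσi] at this; linarith
  -- margins at the corners
  set κ := min (σ 0 + 1) (1 - σ 3) with hκdef
  have hκ : 0 < κ := lt_min (by linarith [(hσI 0).1]) (by linarith [(hσI 3).2])
  have hκ0 : κ ≤ σ 0 + 1 := min_le_left _ _
  have hκ3 : κ ≤ 1 - σ 3 := min_le_right _ _
  have hKκσ0 : K * κ ≤ K * σ 0 + K := by
    have := mul_le_mul_of_nonneg_left hκ0 hK.le; rwa [mul_add, mul_one] at this
  have hKκσ3 : K * κ ≤ K - K * σ 3 := by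
    have := mul_le_mul_of_nonneg_left hκ3 hK.le; rwa [mul_sub, mul_one] at this
  have hs01 : K * σ 0 ≤ K * σ 1 := mul_le_mul_of_nonneg_left (hσmono 0 1 (by decide)) hK.le
  have hs13 : K * σ 1 ≤ K * σ 3 := mul_le_mul_of_nonneg_left (hσmono 1 3 (by decide)) hK.le
  have hs02 : K * σ 0 ≤ K * σ 2 := mul_le_mul_of_nonneg_left (hσmono 0 2 (by decide)) hK.le
  have hs23 : K * σ 2 ≤ K * σ 3 := mul_le_mul_of_nonneg_left (hσmono 2 3 (by decide)) hK.le
  -- Step 4: eventually in `M`, the lattice conditions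
  have hevM2 : ∀ᶠ M : ℕ in atTop, max (1 / e) (max (1 / κ) (2 * K / H)) ≤ (M : ℝ) :=
    tendsto_natCast_atTop_atTop.eventually_ge_atTop _
  have hevM : ∀ᶠ M : ℕ in atTop, ∀ N : ℕ, 2 * M ≤ N → N ≤ 2 * M + 1 →
      cardyFunction (crossRatio (negCos ξ)) - ε < hsProb ξ N := by
    filter_upwards [hevM1, hevM2] with M hM1 hM2 N hMN hNM
    have hM0 : (0 : ℝ) ≤ M := Nat.cast_nonneg M
    have hMe : 1 / e ≤ (M : ℝ) := le_trans (le_max_left _ _) hM2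
    have hMκ : 1 / κ ≤ (M : ℝ) := le_trans (le_trans (le_max_left _ _) (le_max_right _ _)) hM2
    have hMK : 2 * K / H ≤ (M : ℝ) := le_trans (le_trans (le_max_right _ _) (le_max_right _ _)) hM2
    have hM1pos : (0 : ℝ) < (M : ℝ) + 1 := by linarith
    set δ : ℝ := K / ((M : ℝ) + 1) with hδdef
    have hδ : 0 < δ := div_pos hK hM1pos
    have hδK : δ * ((M : ℝ) + 1) = K := by rw [hδdef]; field_simp
    -- `e (M+1) ≥ 1`
    have heM : 1 ≤ e * ((M : ℝ) + 1) := by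
      have h1 : 1 ≤ e * (M : ℝ) := by rwa [div_le_iff₀' he] at hMe
      have h2 : e * ((M : ℝ) + 1) = e * M + e := by ring
      rw [h2]; linarith
    -- `1/(M+1) < κ`, hence `δ < K κ`
    have hinvκ : 1 / ((M : ℝ) + 1) < κ := by
      have h1 : 1 ≤ κ * (M : ℝ) := by rwa [div_le_iff₀' hκ] at hMκ
      rw [div_lt_iff₀ hM1pos]
      have h2 : κ * ((M : ℝ) + 1) = κ * M + κ := by ring
      rw [h2]; linarith
    have hδκ : δ < K * κ := by
      have : δ = K * (1 / ((M : ℝ) + 1)) := by rw [hδdef]; ring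
      rw [this]; exact mul_lt_mul_of_pos_left hinvκ hK
    -- `2 δ < H`
    have hH2 : 2 * δ < H := by
      have h1 : 2 * K ≤ (M : ℝ) * H := by rwa [div_le_iff₀ hH] at hMK
      have h2 : 2 * δ * ((M : ℝ) + 1) = 2 * K := by rw [hδdef]; field_simp
      by_contra hcon
      push Not at hcon
      have h4 : H * ((M : ℝ) + 1) ≤ 2 * δ * ((M : ℝ) + 1) := mul_le_mul_of_nonneg_right hcon hM1pos.le
      have h5 : H * ((M : ℝ) + 1) = M * H + H := by ring
      rw [h5, h2] at h4
      linarith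
    have hNreal1 : (2 * M : ℝ) ≤ N := by exact_mod_cast hMN
    have hNreal2 : (N : ℝ) ≤ 2 * M + 1 := by exact_mod_cast hNM
    have hmdiv : ∀ m : ℤ, δ * (m : ℝ) = K * ((m : ℝ) / ((M : ℝ) + 1)) := fun m => by
      rw [hδdef]; ring
    have hbox := bondDomainCrossingProb_le_hsProb (ξ := ξ) (N := N) hK hδ hH2 (le_of_eq hδK.symm) hMN
      (s₀ := ellipticF (k ^ 2) (v 0)) (s₁ := ellipticF (k ^ 2) (v 1))
      (s₂ := ellipticF (k ^ 2) (v 2)) (s₃ := ellipticF (k ^ 2) (v 3))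
      (by rw [hsσ 0, hsσ 1]; exact hs01)
      (by rw [hsσ 2, hsσ 3]; exact hs23)
      (by rw [hsσ 0]; linarith)
      (by rw [hsσ 1]; linarith)
      (by rw [hsσ 2]; linarith)
      (by rw [hsσ 3]; linarith)
      (fun m hm => by
        rw [hsσ 0, hmdiv] at hm
        have hm' : σ 0 * ((M : ℝ) + 1) ≤ m := by
          have := le_of_mul_le_mul_left hm hK
          rwa [le_div_iff₀ hM1pos] at this
        have key := key_lo_left hσ0 h0 hm' heM hM0
        have h1 : ((⌊ξ 0 * (N : ℝ)⌋₊ : ℕ) : ℝ) ≤ ξ 0 * N := Nat.floor_le (by positivity)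
        have h2 : ξ 0 * (N : ℝ) ≤ ξ 0 * (2 * M + 1) := mul_le_mul_of_nonneg_left hNreal2 h0
        have : ((⌊ξ 0 * (N : ℝ)⌋₊ : ℕ) : ℝ) ≤ (m : ℝ) + M := by linarith
        exact_mod_cast this)
      (fun m hm => by
        rw [hsσ 1, hmdiv] at hm
        have hm' : (m : ℝ) ≤ σ 1 * ((M : ℝ) + 1) := by
          have := le_of_mul_le_mul_left hm hK
          rwa [div_le_iff₀ hM1pos] at this
        have key := key_lo_right hσ1 hξ11 hm' heM hM0
        have h2 : ξ 1 * (2 * (M : ℝ)) ≤ ξ 1 * N := mul_le_mul_of_nonneg_left hNreal1 hξ1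
        rw [Int.natCast_floor_eq_floor (by positivity)]
        exact Int.le_floor.2 (by push_cast; linarith))
      (fun m hm => by
        rw [hsσ 2, hmdiv] at hm
        have hm' : σ 2 * ((M : ℝ) + 1) ≤ m := by
          have := le_of_mul_le_mul_left hm hK
          rwa [le_div_iff₀ hM1pos] at this
        have key := key_lo_left hσ2 hξ2 hm' heM hM0
        have h1 : ((⌊ξ 2 * (N : ℝ)⌋₊ : ℕ) : ℝ) ≤ ξ 2 * N := Nat.floor_le (by positivity)
        have h2 : ξ 2 * (N : ℝ) ≤ ξ 2 * (2 * M + 1) := mul_le_mul_of_nonneg_left hNreal2 hξ2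
        have : ((⌊ξ 2 * (N : ℝ)⌋₊ : ℕ) : ℝ) ≤ (m : ℝ) + M := by linarith
        exact_mod_cast this)
      (fun m hm => by
        rw [hsσ 3, hmdiv] at hm
        have hm' : (m : ℝ) ≤ σ 3 * ((M : ℝ) + 1) := by
          have := le_of_mul_le_mul_left hm hK
          rwa [div_le_iff₀ hM1pos] at this
        have key := key_lo_right hσ3 h3 hm' heM hM0
        have h33 : 0 ≤ ξ 3 := hξ2.trans (hξ (by decide : (2 : Fin 4) < 3)).le
        have h2 : ξ 3 * (2 * (M : ℝ)) ≤ ξ 3 * N := mul_le_mul_of_nonneg_left hNreal1 h33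
        rw [Int.natCast_floor_eq_floor (by positivity)]
        exact Int.le_floor.2 (by push_cast; linarith))
      R hRc hR0 hR2
    linarith
  -- Step 5: from `M` to `N`
  obtain ⟨M₀, hM₀⟩ := hevM.exists_forall_of_atTop
  filter_upwards [eventually_ge_atTop (2 * M₀)] with N hN
  obtain ⟨h1, h2⟩ := two_mul_div_two_le N
  exact hM₀ (N / 2) (by omega) N h1 h2

end Summit.CriticalPhenomena.CardyFormulaZ2.Cruxes.HalfStripCardyZ2.Necessity


namespace Summit.CriticalPhenomena.CardyFormulaZ2.Cruxes.HalfStripCardyZ2.Necessity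

open Set Metric MeasureTheory Filter
open Literature.Probability.LatticeModels
open Literature.Probability.Percolation hiding cardyFunction
open Literature.Probability.RandomPlanarGeometry
open UpperHalfPlane (upperHalfPlaneSet)
open Summit.CriticalPhenomena.CardyFormulaZ2.Theorems.HalfPlaneMarkDensityLaw.Negative (μ)
open Summit.CriticalPhenomena.CardyFormulaZ2.Cruxes.HalfPlaneMarkDensityLaw.SketchLine.BoxExhaustion
  (continuousAt_crossRatio crossRatio_den_ne_zero tendsto_const_mul_inv_rpow)
open Summit.CriticalPhenomena.CardyFormulaZ2.Theses.CardyPerronTeleport (HalfStripCardyZ2 UniqueConformalLimit)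
open scoped Topology

/-! ### UPPER bound: enlarged arcs in a slightly wider, tall box -/

/-- The enlarged marks, in the contracted coordinates of the wider box. [folklore] -/
def zup (ξ : Fin 4 → ℝ) (e : ℝ) : Fin 4 → ℝ :=
  ![(ξ 0 + e) / (1 + 2 * e) - e / 4, (ξ 1 + e) / (1 + 2 * e) + e / 4,
    (ξ 2 + e) / (1 + 2 * e) - e / 4, (ξ 3 + e) / (1 + 2 * e) + e / 4]

theorem zup_apply (ξ : Fin 4 → ℝ) (e : ℝ) :
    zup ξ e 0 = (ξ 0 + e) / (1 + 2 * e) - e / 4 ∧ zup ξ e 1 = (ξ 1 + e) / (1 + 2 * e) + e / 4 ∧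
      zup ξ e 2 = (ξ 2 + e) / (1 + 2 * e) - e / 4 ∧ zup ξ e 3 = (ξ 3 + e) / (1 + 2 * e) + e / 4 := by
  simp [zup]

/-- The enlarged marks tend to `ξ` as `e → 0⁺`. [folklore] -/
theorem tendsto_zup (ξ : Fin 4 → ℝ) : Tendsto (zup ξ) (𝓝[>] 0) (𝓝 ξ) := by
  apply tendsto_nhdsWithin_of_tendsto_nhds
  rw [tendsto_pi_nhds]
  have hsub : ∀ a : ℝ, Tendsto (fun e : ℝ => (a + e) / (1 + 2 * e) - e / 4) (𝓝 0) (𝓝 a) := by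
    intro a
    have hc : ContinuousAt (fun e : ℝ => (a + e) / (1 + 2 * e) - e / 4) 0 :=
      ContinuousAt.sub (ContinuousAt.div (by fun_prop) (by fun_prop) (by norm_num)) (by fun_prop)
    simpa using hc.tendsto
  have hadd : ∀ a : ℝ, Tendsto (fun e : ℝ => (a + e) / (1 + 2 * e) + e / 4) (𝓝 0) (𝓝 a) := by
    intro a
    have hc : ContinuousAt (fun e : ℝ => (a + e) / (1 + 2 * e) + e / 4) 0 :=
      ContinuousAt.add (ContinuousAt.div (by fun_prop) (by fun_prop) (by norm_num)) (by fun_prop)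
    simpa using hc.tendsto
  intro i
  fin_cases i
  · exact (hsub (ξ 0)).congr fun e => by simp [zup]
  · exact (hadd (ξ 1)).congr fun e => by simp [zup]
  · exact (hsub (ξ 2)).congr fun e => by simp [zup]
  · exact (hadd (ξ 3)).congr fun e => by simp [zup]

/-- For small `e > 0` the enlarged marks are strictly increasing and interior (even when `ξ₀ = 0` or
`ξ₃ = 1`). [folklore] -/
theorem zup_props {ξ : Fin 4 → ℝ} (hξ : StrictMono ξ) (h0 : 0 ≤ ξ 0) (h3 : ξ 3 ≤ 1) {e : ℝ} (he : 0 < e)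
    (he1 : e < 1) (he2 : 3 * e ≤ 2 * (ξ 2 - ξ 1)) :
    StrictMono (zup ξ e) ∧ 0 < zup ξ e 0 ∧ zup ξ e 3 < 1 := by
  obtain ⟨e0, e1', e2, e3⟩ := zup_apply ξ e
  have hD : 0 < 1 + 2 * e := by linarith
  have h01 : ξ 0 < ξ 1 := hξ (by decide)
  have h23 : ξ 2 < ξ 3 := hξ (by decide)
  have hee : e * e < e * 1 := mul_lt_mul_of_pos_left he1 he
  have d01 : (ξ 0 + e) / (1 + 2 * e) < (ξ 1 + e) / (1 + 2 * e) :=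
    div_lt_div_of_pos_right (by linarith) hD
  have d23 : (ξ 2 + e) / (1 + 2 * e) < (ξ 3 + e) / (1 + 2 * e) :=
    div_lt_div_of_pos_right (by linarith) hD
  have hx : e / 2 < (ξ 2 - ξ 1) / (1 + 2 * e) := by
    rw [lt_div_iff₀ hD]; nlinarith
  have d12 : (ξ 1 + e) / (1 + 2 * e) + e / 2 < (ξ 2 + e) / (1 + 2 * e) := by
    have : (ξ 1 + e) / (1 + 2 * e) + (ξ 2 - ξ 1) / (1 + 2 * e) = (ξ 2 + e) / (1 + 2 * e) := by
      rw [← add_div]; congr 1; ring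
    linarith
  have hz0 : 0 < (ξ 0 + e) / (1 + 2 * e) - e / 4 := by
    rw [sub_pos, div_lt_div_iff₀ (by norm_num : (0:ℝ) < 4) hD]
    nlinarith
  have hz3 : (ξ 3 + e) / (1 + 2 * e) + e / 4 < 1 := by
    have : (ξ 3 + e) / (1 + 2 * e) < 1 - e / 4 := by
      rw [div_lt_iff₀ hD]; nlinarith
    linarith
  refine ⟨Fin.strictMono_iff_lt_succ.2 fun i => ?_, by rw [e0]; exact hz0, by rw [e3]; exact hz3⟩
  fin_cases i <;> simp [zup] <;> linarith

set_option maxHeartbeats 800000 in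
/-- **UPPER half of the sandwich**: eventually `P_N(ξ) < F(η) + ε`. [folklore] -/
theorem upper_eventually (hS : _root_.CardyFormulaZ2) {ξ : Fin 4 → ℝ} (hξ : StrictMono ξ)
    (h0 : 0 ≤ ξ 0) (h3 : ξ 3 ≤ 1) {ε : ℝ} (hε : 0 < ε) :
    ∀ᶠ N : ℕ in atTop, hsProb ξ N < cardyFunction (crossRatio (negCos ξ)) + ε := by
  have hξ1 : 0 ≤ ξ 1 := h0.trans (hξ (by decide : (0 : Fin 4) < 1)).le
  have hξ2 : 0 ≤ ξ 2 := h0.trans (hξ (by decide : (0 : Fin 4) < 2)).le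
  have hξ3 : 0 ≤ ξ 3 := h0.trans (hξ (by decide : (0 : Fin 4) < 3)).le
  have hξ01 : ξ 0 ≤ 1 := (hξ (by decide : (0 : Fin 4) < 3)).le.trans h3
  have hξ11 : ξ 1 ≤ 1 := (hξ (by decide : (1 : Fin 4) < 3)).le.trans h3
  have hξ21 : ξ 2 ≤ 1 := (hξ (by decide : (2 : Fin 4) < 3)).le.trans h3
  -- Step 0: the escape constants and the height factor `h₁`
  obtain ⟨C, α, hC, hα, hesc⟩ := exists_real_boxToFar_le_rpow_of_le_half
  have hev_h : ∀ᶠ h : ℕ in atTop, C * ((h : ℝ)⁻¹) ^ α < ε / 3 :=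
    (tendsto_const_mul_inv_rpow C hα) (Iio_mem_nhds (by positivity))
  obtain ⟨h₁, hh₁ε, hh₁⟩ := (hev_h.and (eventually_ge_atTop 1)).exists
  -- Step 1: the widening parameter `e`
  have hgap : 0 < ξ 2 - ξ 1 := sub_pos.2 (hξ (by decide))
  have hcont := tendsto_cardy_negCos hξ h0 h3 (tendsto_zup ξ)
  have hev1 : ∀ᶠ e in 𝓝[>] (0 : ℝ), cardyFunction (crossRatio (negCos (zup ξ e))) <
      cardyFunction (crossRatio (negCos ξ)) + ε / 3 :=
    hcont (Iio_mem_nhds (by linarith))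
  have hev2 : ∀ᶠ e in 𝓝[>] (0 : ℝ), e ∈ Ioo 0 (min (1 / 2) ((ξ 2 - ξ 1) / 2)) :=
    Ioo_mem_nhdsGT (lt_min (by norm_num) (by linarith))
  obtain ⟨e, he1, he2⟩ := (hev1.and hev2).exists
  have he : 0 < e := he2.1
  have he' : e < 1 := by have := (lt_min_iff.1 he2.2).1; linarith
  have he'' : 3 * e ≤ 2 * (ξ 2 - ξ 1) := by have := (lt_min_iff.1 he2.2).2; linarith
  obtain ⟨hζm, hζ0, hζ3⟩ := zup_props hξ h0 h3 he he' he''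
  obtain ⟨ez0, ez1, ez2, ez3⟩ := zup_apply ξ e
  set ζ := zup ξ e with hζdef
  have hζ01 : ∀ i, ζ i ∈ Icc (0 : ℝ) 1 := fun i =>
    ⟨hζ0.le.trans (hζm.monotone (Fin.zero_le i)), (hζm.monotone (Fin.le_last i)).trans hζ3.le⟩
  -- Step 2: the modulus `k` (margin `e/4`, aspect `4 h₁`)
  obtain ⟨k, hk0, hk1, hσ, hasp⟩ := exists_modulus ζ hζ01 (by positivity : (0 : ℝ) < e / 4) (4 * h₁)
  set v := negCos ζ with hvdef
  have hvm : StrictMono v := strictMono_negCos hζm hζ0.le hζ3.le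
  have hvI : ∀ i, v i ∈ Ioo (-1 : ℝ) 1 := negCos_mem_Ioo hζm hζ0 hζ3
  have hvI' : ∀ i, v i ∈ Icc (-1 : ℝ) 1 := fun i => Ioo_subset_Icc_self (hvI i)
  obtain ⟨R, hRc, hR0, hR2, φ, hφ⟩ := exists_scBox_gen hk0 hk1 v hvm hvI
  set K := ellipticK (k ^ 2) with hKdef
  set H := ellipticK (1 - k ^ 2) with hHdef
  have hK : 0 < K := ellipticK_sq_pos hk0 hk1
  have hH : 0 < H := ellipticK_one_sub_sq_pos hk0 hk1
  have hHK : 4 * (h₁ : ℝ) * K ≤ H := hasp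
  have hh₁r : (1 : ℝ) ≤ h₁ := by exact_mod_cast hh₁
  -- the meshes `K/(M'(N)+1)`, `M'(N) = N/2 + ⌊2e(N/2)⌋ + 1`
  set M' : ℕ → ℕ := fun N => N / 2 + (⌊2 * e * ((N / 2 : ℕ) : ℝ)⌋₊ + 1) with hM'def
  have hM'top : Tendsto M' atTop atTop := by
    refine tendsto_atTop_atTop.2 fun b => ⟨2 * b, fun N hN => ?_⟩
    have := two_mul_div_two_le N
    show b ≤ N / 2 + (⌊2 * e * ((N / 2 : ℕ) : ℝ)⌋₊ + 1)
    omega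
  have hlim : Tendsto (fun N : ℕ => bondDomainCrossingProb R (K / ((M' N : ℝ) + 1))) atTop
      (𝓝 (cardyFunction (crossRatio v))) :=
    (hS R φ v hφ).comp ((tendsto_div_natSucc_nhdsWithin hK).comp hM'top)
  have hevN1 : ∀ᶠ N : ℕ in atTop, bondDomainCrossingProb R (K / ((M' N : ℝ) + 1)) <
      cardyFunction (crossRatio v) + ε / 3 :=
    hlim (Iio_mem_nhds (by linarith))
  -- relative positions
  set σ : Fin 4 → ℝ := fun i => ellipticF (k ^ 2) (v i) / K with hσdef
  have hσi : ∀ i, ellipticF (k ^ 2) (v i) / K = σ i := fun i => rfl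
  have hsσ : ∀ i, ellipticF (k ^ 2) (v i) = K * σ i := fun i => by
    rw [← hσi]; field_simp
  have hσI : ∀ i, σ i ∈ Ioo (-1 : ℝ) 1 := fun i => relPos_mem_Ioo hk0 hk1 (hvI i)
  have hσmono : ∀ i j, i ≤ j → σ i ≤ σ j := fun i j hij =>
    relPos_le_relPos hk0 hk1 (hvI' i) (hvI' j) (hvm.monotone hij)
  have hDne : (1 + 2 * e : ℝ) ≠ 0 := by positivity
  have hρ0 : 2 * ζ 0 - 1 = (2 * ξ 0 - 1) / (1 + 2 * e) - e / 2 := by rw [ez0]; field_simp; ring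
  have hρ1 : 2 * ζ 1 - 1 = (2 * ξ 1 - 1) / (1 + 2 * e) + e / 2 := by rw [ez1]; field_simp; ring
  have hρ2 : 2 * ζ 2 - 1 = (2 * ξ 2 - 1) / (1 + 2 * e) - e / 2 := by rw [ez2]; field_simp; ring
  have hρ3 : 2 * ζ 3 - 1 = (2 * ξ 3 - 1) / (1 + 2 * e) + e / 2 := by rw [ez3]; field_simp; ring
  have hσ0 : σ 0 ≤ (2 * ξ 0 - 1) / (1 + 2 * e) - e / 4 := by
    have := (abs_lt.1 (hσ 0)).2; rw [hρ0, hσi] at this; linarith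
  have hσ1 : (2 * ξ 1 - 1) / (1 + 2 * e) + e / 4 ≤ σ 1 := by
    have := (abs_lt.1 (hσ 1)).1; rw [hρ1, hσi] at this; linarith
  have hσ2 : σ 2 ≤ (2 * ξ 2 - 1) / (1 + 2 * e) - e / 4 := by
    have := (abs_lt.1 (hσ 2)).2; rw [hρ2, hσi] at this; linarith
  have hσ3 : (2 * ξ 3 - 1) / (1 + 2 * e) + e / 4 ≤ σ 3 := by
    have := (abs_lt.1 (hσ 3)).1; rw [hρ3, hσi] at this; linarith
  -- margins at the corners
  set κ := min (σ 0 + 1) (1 - σ 3) with hκdef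
  have hκ : 0 < κ := lt_min (by linarith [(hσI 0).1]) (by linarith [(hσI 3).2])
  have hκ0 : κ ≤ σ 0 + 1 := min_le_left _ _
  have hκ3 : κ ≤ 1 - σ 3 := min_le_right _ _
  have hKκσ0 : K * κ ≤ K * σ 0 + K := by
    have := mul_le_mul_of_nonneg_left hκ0 hK.le; rwa [mul_add, mul_one] at this
  have hKκσ3 : K * κ ≤ K - K * σ 3 := by
    have := mul_le_mul_of_nonneg_left hκ3 hK.le; rwa [mul_sub, mul_one] at this
  have hs13 : K * σ 1 ≤ K * σ 3 := mul_le_mul_of_nonneg_left (hσmono 1 3 (by decide)) hK.le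
  have hs02 : K * σ 0 ≤ K * σ 2 := mul_le_mul_of_nonneg_left (hσmono 0 2 (by decide)) hK.le
  -- Step 3: eventually in `N`
  have hevN2 : ∀ᶠ N : ℕ in atTop, max (24 / e + 2) (2 / κ + 2) ≤ (N : ℝ) :=
    tendsto_natCast_atTop_atTop.eventually_ge_atTop _
  filter_upwards [hevN1, hevN2] with N hbd hN2
  have hNe : 24 / e + 2 ≤ (N : ℝ) := le_trans (le_max_left _ _) hN2
  have hNκ : 2 / κ + 2 ≤ (N : ℝ) := le_trans (le_max_right _ _) hN2
  have hN1 : 1 ≤ N := by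
    have h24 : 0 < 24 / e := by positivity
    have : (1 : ℝ) ≤ N := by linarith
    exact_mod_cast this
  have hN0 : (N : ℝ) ≠ 0 := by positivity
  -- `M = N/2`, `L = ⌊2eM⌋ + 1`, `M' = M + L`
  set M : ℕ := N / 2 with hMdef
  obtain ⟨hMN, hNM⟩ := two_mul_div_two_le N
  rw [← hMdef] at hMN hNM
  have hMNr : (2 * M : ℝ) ≤ N := by exact_mod_cast hMN
  have hNMr : (N : ℝ) ≤ 2 * M + 1 := by exact_mod_cast hNM
  have hM0 : (0 : ℝ) ≤ M := Nat.cast_nonneg M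
  set L : ℕ := ⌊2 * e * (M : ℝ)⌋₊ + 1 with hLdef
  have hL1 : 2 * e * (M : ℝ) < L := by rw [hLdef]; push_cast; exact Nat.lt_floor_add_one _
  have hL2 : (L : ℝ) ≤ 2 * e * M + 1 := by
    rw [hLdef]; push_cast; linarith [Nat.floor_le (by positivity : 0 ≤ 2 * e * (M : ℝ))]
  have hL1' : (1 : ℝ) ≤ L := by
    have : 1 ≤ L := by rw [hLdef]; omega
    exact_mod_cast this
  have hM'N : (M' N : ℝ) = M + L := by
    show ((N / 2 + (⌊2 * e * ((N / 2 : ℕ) : ℝ)⌋₊ + 1) : ℕ) : ℝ) = M + L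
    rw [← hMdef, ← hLdef]; push_cast; ring
  have hM'pos : (0 : ℝ) < (M' N : ℝ) + 1 := by rw [hM'N]; linarith
  -- the key sizes: `e M ≥ 12`, `1/(M'+1) ≤ κ`
  have heM : 12 ≤ e * (M : ℝ) := by
    have h2 : 24 ≤ e * (2 * (M : ℝ) - 1) :=
      (div_le_iff₀' he).1 (by linarith : 24 / e ≤ 2 * (M : ℝ) - 1)
    have e2 : e * (2 * (M : ℝ) - 1) = 2 * (e * M) - e := by ring
    rw [e2] at h2
    linarith
  have hinvκ : 1 / ((M' N : ℝ) + 1) ≤ κ := by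
    rw [div_le_iff₀ hM'pos, hM'N]
    have h2 : 2 ≤ κ * (2 * (M : ℝ) - 1) :=
      (div_le_iff₀' hκ).1 (by linarith : 2 / κ ≤ 2 * (M : ℝ) - 1)
    have e1 : κ * ((M : ℝ) + L + 1) = κ * M + κ * L + κ := by ring
    have e2 : κ * (2 * (M : ℝ) - 1) = 2 * (κ * M) - κ := by ring
    have hκL : 0 ≤ κ * (L : ℝ) := by positivity
    rw [e1]; rw [e2] at h2
    linarith
  set δ : ℝ := K / ((M' N : ℝ) + 1) with hδdef
  have hδ : 0 < δ := div_pos hK hM'pos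
  have hδK : δ * ((M' N : ℝ) + 1) = K := by rw [hδdef]; field_simp
  have hδκ : δ ≤ K * κ := by
    have : δ = K * (1 / ((M' N : ℝ) + 1)) := by rw [hδdef]; ring
    rw [this]; exact mul_le_mul_of_nonneg_left hinvκ hK.le
  have hδleK : δ ≤ K := by
    rw [hδdef]; exact div_le_self hK.le (by linarith)
  have hH2 : 2 * δ ≤ H := by
    have h1 : K ≤ (h₁ : ℝ) * K := le_mul_of_one_le_left hK.le hh₁r
    have hHK' : 4 * ((h₁ : ℝ) * K) ≤ H := by
      have e1 : 4 * ((h₁ : ℝ) * K) = 4 * (h₁ : ℝ) * K := by ring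
      rw [e1]; exact hHK
    linarith
  -- the four mark inequalities
  have hmdiv : ∀ x : ℝ, δ * x = K * (x / ((M' N : ℝ) + 1)) := fun x => by rw [hδdef]; ring
  have hfl0 : ξ 0 * (2 * (M : ℝ)) - 1 ≤ ((⌊ξ 0 * (N : ℝ)⌋₊ : ℕ) : ℝ) := by
    have h1 : ξ 0 * (N : ℝ) < ((⌊ξ 0 * (N : ℝ)⌋₊ : ℕ) : ℝ) + 1 := Nat.lt_floor_add_one _
    have h2 : ξ 0 * (2 * (M : ℝ)) ≤ ξ 0 * N := mul_le_mul_of_nonneg_left hMNr h0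
    linarith
  have hfl2 : ξ 2 * (2 * (M : ℝ)) - 1 ≤ ((⌊ξ 2 * (N : ℝ)⌋₊ : ℕ) : ℝ) := by
    have h1 : ξ 2 * (N : ℝ) < ((⌊ξ 2 * (N : ℝ)⌋₊ : ℕ) : ℝ) + 1 := Nat.lt_floor_add_one _
    have h2 : ξ 2 * (2 * (M : ℝ)) ≤ ξ 2 * N := mul_le_mul_of_nonneg_left hMNr hξ2
    linarith
  have hfl1 : ((⌊ξ 1 * (N : ℝ)⌋₊ : ℕ) : ℝ) ≤ ξ 1 * (2 * (M : ℝ) + 1) := by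
    have h1 : ((⌊ξ 1 * (N : ℝ)⌋₊ : ℕ) : ℝ) ≤ ξ 1 * N := Nat.floor_le (by positivity)
    have h2 : ξ 1 * (N : ℝ) ≤ ξ 1 * (2 * M + 1) := mul_le_mul_of_nonneg_left hNMr hξ1
    linarith
  have hfl3 : ((⌊ξ 3 * (N : ℝ)⌋₊ : ℕ) : ℝ) ≤ ξ 3 * (2 * (M : ℝ) + 1) := by
    have h1 : ((⌊ξ 3 * (N : ℝ)⌋₊ : ℕ) : ℝ) ≤ ξ 3 * N := Nat.floor_le (by positivity)
    have h2 : ξ 3 * (N : ℝ) ≤ ξ 3 * (2 * M + 1) := mul_le_mul_of_nonneg_left hNMr hξ3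
    linarith
  have key0 := key_up_left he h0 hξ01 hσ0 hL1 hL2 heM hM0
  have key1 := key_up_right he hξ1 hξ11 hσ1 hL1 hL2 heM hM0
  have key2 := key_up_left he hξ2 hξ21 hσ2 hL1 hL2 heM hM0
  have key3 := key_up_right he hξ3 h3 hσ3 hL1 hL2 heM hM0
  have hbox := hsProb_le_bondDomainCrossingProb_add (ξ := ξ) (N := N) (T := ((M : ℕ) : ℤ))
    (R' := h₁ * N) hK hδ hH2
    (by
      push_cast
      have hMlt : (M : ℝ) < (M' N : ℝ) + 1 := by rw [hM'N]; linarith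
      have h1 : δ * (M : ℝ) < K := by
        rw [hmdiv]
        calc K * ((M : ℝ) / ((M' N : ℝ) + 1)) < K * 1 :=
              mul_lt_mul_of_pos_left ((div_lt_one hM'pos).2 hMlt) hK
          _ = K := mul_one K
      have e1 : δ * -(M : ℝ) = -(δ * M) := by ring
      rw [e1]
      linarith)
    (by
      push_cast
      have h1 : (N : ℝ) - M < (M' N : ℝ) + 1 := by rw [hM'N]; linarith
      calc δ * ((N : ℝ) - M) < δ * ((M' N : ℝ) + 1) := mul_lt_mul_of_pos_left h1 hδ
        _ = K := hδK)
    (by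
      push_cast
      have hM'ge : ((N : ℝ) + 3) / 2 ≤ (M' N : ℝ) + 1 := by rw [hM'N]; linarith
      have hlt : (h₁ : ℝ) * N + 1 < 4 * h₁ * ((M' N : ℝ) + 1) := by
        have h2 := mul_le_mul_of_nonneg_left hM'ge (by positivity : (0 : ℝ) ≤ 4 * h₁)
        have e2 : 4 * (h₁ : ℝ) * (((N : ℝ) + 3) / 2) = 2 * (h₁ * N) + 6 * h₁ := by ring
        rw [e2] at h2
        have h3 : (0 : ℝ) ≤ h₁ * N := by positivity
        linarith
      have h1 : K * ((h₁ : ℝ) * N + 1) < H * ((M' N : ℝ) + 1) := by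
        calc K * ((h₁ : ℝ) * N + 1) < K * (4 * h₁ * ((M' N : ℝ) + 1)) :=
              mul_lt_mul_of_pos_left hlt hK
          _ = (4 * h₁ * K) * ((M' N : ℝ) + 1) := by ring
          _ ≤ H * ((M' N : ℝ) + 1) := mul_le_mul_of_nonneg_right hHK hM'pos.le
      rw [hmdiv, ← mul_div_assoc, div_lt_iff₀ hM'pos]
      exact h1)
    (s₀ := ellipticF (k ^ 2) (v 0)) (s₁ := ellipticF (k ^ 2) (v 1))
    (s₂ := ellipticF (k ^ 2) (v 2)) (s₃ := ellipticF (k ^ 2) (v 3))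
    (by rw [hsσ 0]; linarith)
    (by rw [hsσ 1]; linarith)
    (by rw [hsσ 2]; linarith)
    (by rw [hsσ 3]; linarith)
    (by
      rw [hsσ 0]; push_cast
      have h1 : σ 0 * ((M' N : ℝ) + 1) ≤ ((⌊ξ 0 * (N : ℝ)⌋₊ : ℕ) : ℝ) - M := by
        rw [hM'N]; linarith
      rw [hmdiv]
      exact mul_le_mul_of_nonneg_left ((le_div_iff₀ hM'pos).2 h1) hK.le)
    (by
      rw [hsσ 1]; push_cast
      have h1 : ((⌊ξ 1 * (N : ℝ)⌋₊ : ℕ) : ℝ) - M ≤ σ 1 * ((M' N : ℝ) + 1) := by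
        rw [hM'N]; linarith
      rw [hmdiv]
      exact mul_le_mul_of_nonneg_left ((div_le_iff₀ hM'pos).2 h1) hK.le)
    (by
      rw [hsσ 2]; push_cast
      have h1 : σ 2 * ((M' N : ℝ) + 1) ≤ ((⌊ξ 2 * (N : ℝ)⌋₊ : ℕ) : ℝ) - M := by
        rw [hM'N]; linarith
      rw [hmdiv]
      exact mul_le_mul_of_nonneg_left ((le_div_iff₀ hM'pos).2 h1) hK.le)
    (by
      rw [hsσ 3]; push_cast
      have h1 : ((⌊ξ 3 * (N : ℝ)⌋₊ : ℕ) : ℝ) - M ≤ σ 3 * ((M' N : ℝ) + 1) := by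
        rw [hM'N]; linarith
      rw [hmdiv]
      exact mul_le_mul_of_nonneg_left ((div_le_iff₀ hM'pos).2 h1) hK.le)
    R hRc hR0 hR2
  -- the escape term
  have hh0 : (h₁ : ℝ) ≠ 0 := by positivity
  have hesc' : μ.real {ω | ∃ x ∈ box 2 N, ∃ y ∉ box 2 (h₁ * N), ω ∈ openConnIn univ x y} ≤
      C * ((h₁ : ℝ)⁻¹) ^ α := by
    have h := hesc half (by simp) N (h₁ * N) hN1 (Nat.le_mul_of_pos_left N hh₁)
    have hratio : ((N : ℝ) / ((h₁ * N : ℕ) : ℝ)) = (h₁ : ℝ)⁻¹ := by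
      push_cast; field_simp
    rw [hratio] at h
    exact h
  linarith

/-! ### The necessity theorem and its corollaries -/

/-- **`CardyFormulaZ2 → HalfStripCardyZ2`** (the crux `HalfStripCardyZ2`, stmt-CriticalPhenomena-5178, is
a CONSEQUENCE of the conjunct it serves): Cardy's formula for bond-`ℤ²` in every bounded Jordan conformal
rectangle implies Cardy's formula on half-strip ends, by exhausting the half-strip `{0,…,N} × ℕ` with the
Schwarz–Christoffel boxes `(-K(k²), K(k²)) × (0, K(1-k²))` of modulus `k → 0⁺` whose bottom marks have the
PRESCRIBED prevertices `-cos(π ζᵢ)` (so that their Cardy value is known exactly), a lattice sandwich with `o(N)`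
slack in the arcs, and the RSW one-arm bound for the truncation in height. [folklore] -/
theorem halfStripCardyZ2_of_cardyFormulaZ2 (hS : _root_.CardyFormulaZ2) : HalfStripCardyZ2 := by
  rw [halfStripCardyZ2_iff]
  intro ξ hξ h0 h3
  rw [Metric.tendsto_atTop]
  intro ε hε
  obtain ⟨N₀, hN₀⟩ :=
    ((lower_eventually hS hξ h0 h3 hε).and (upper_eventually hS hξ h0 h3 hε)).exists_forall_of_atTop
  refine ⟨N₀, fun N hN => ?_⟩
  obtain ⟨h1, h2⟩ := hN₀ N hN
  rw [Real.dist_eq, abs_lt]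
  change cardyFunction (crossRatio (negCos ξ)) - ε < hsProb ξ N at h1
  change hsProb ξ N < cardyFunction (crossRatio (negCos ξ)) + ε at h2
  change -ε < hsProb ξ N - cardyFunction (crossRatio (negCos ξ)) ∧
    hsProb ξ N - cardyFunction (crossRatio (negCos ξ)) < ε
  constructor <;> linarith

/-- **The conjunct is equivalent to the pair (half-strip Cardy, universal conformal limit)**:
`CardyFormulaZ2 ↔ HalfStripCardyZ2 ∧ UniqueConformalLimit` — route CardyPerronTeleport's deciding theorem
(`←`, tree: `cardyFormulaZ2_of_halfStripCardyZ2_of_uniqueConformalLimit`) together with the necessity of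
both cruxes (`→`: this file and `uniqueConformalLimit_of_cardyFormulaZ2`). [folklore] -/
theorem cardyFormulaZ2_iff_halfStripCardyZ2_and_uniqueConformalLimit :
    _root_.CardyFormulaZ2 ↔ (HalfStripCardyZ2 ∧ UniqueConformalLimit) :=
  ⟨fun h => ⟨halfStripCardyZ2_of_cardyFormulaZ2 h,
      Summit.CriticalPhenomena.CardyFormulaZ2.Cruxes.HalfPlaneMarkDensityLaw.SketchLine.uniqueConformalLimit_of_cardyFormulaZ2
        h⟩,
    fun h =>
      Summit.CriticalPhenomena.CardyFormulaZ2.Cruxes.HalfPlaneMarkDensityLaw.SketchLine.cardyFormulaZ2_of_halfStripCardyZ2_of_uniqueConformalLimit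
        h.1 h.2⟩

/-- **Modulo the route's declared residual `X_U`, the deciding crux IS the conjunct**:
`UniqueConformalLimit → (HalfStripCardyZ2 ↔ CardyFormulaZ2)`. [folklore] -/
theorem halfStripCardyZ2_iff_cardyFormulaZ2_of_uniqueConformalLimit (hU : UniqueConformalLimit) :
    HalfStripCardyZ2 ↔ _root_.CardyFormulaZ2 :=
  ⟨fun h => cardyFormulaZ2_iff_halfStripCardyZ2_and_uniqueConformalLimit.2 ⟨h, hU⟩,
    halfStripCardyZ2_of_cardyFormulaZ2⟩

/-- **Negation side**: a counterexample to the crux refutes the conjunct — `¬ HalfStripCardyZ2 → ¬ CardyFormulaZ2`.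
[folklore] -/
theorem not_cardyFormulaZ2_of_not_halfStripCardyZ2 : ¬ HalfStripCardyZ2 → ¬ _root_.CardyFormulaZ2 :=
  mt halfStripCardyZ2_of_cardyFormulaZ2

end Summit.CriticalPhenomena.CardyFormulaZ2.Cruxes.HalfStripCardyZ2.Necessity

end
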